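import Mathlib
import Literature.NumberTheory.LFunctions.Zhang2022.SkeletonPartTwo
import Literature.NumberTheory.LFunctions.Zhang2022.SkeletonPartOneC
import Literature.NumberTheory.LFunctions.Zhang2022.Section8cStatements
import Literature.NumberTheory.LFunctions.Zhang2022.Section8dStatements
import Literature.NumberTheory.LFunctions.Zhang2022.Section8ChangeOfVariables
import Literature.NumberTheory.LFunctions.Zhang2022.Section8ArithmeticIdentity
import HarnessLib

/-!
# Zhang (2022) §8, typed statements B: Lemmas 8.2–8.4 and their proofs, the four `ϰ`-sums,
# (8.9)–(8.14) — tex L2339–L2490, PDF pp. 45–49 (campaign layer L2, file `TypedSection08B`)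

Topic `Literature/NumberTheory/LFunctions/Zhang2022` (Landau–Siegel audit tree; verdict-neutral).
Y. Zhang, *Discrete mean estimates and the Landau–Siegel zero*, arXiv:2211.02515v1 (2022)
[Zhang2022LandauSiegel] — **an unrefereed manuscript under adjudication. Every `def … : Prop` below
is a CLAIM OF THE MANUSCRIPT, STATED NOT ASSERTED** (a displayed statement of §8, typed
statement-exact over the banked skeleton objects, with its locator `[Z22 p.<PDF page>, tex L<line>]`);
nothing here asserts or denies Theorems 1–2 of the source, and typed ≠ discharged.

This file types the 37 DAG nodes `Z22:Lem8.2 … Z22:(8.14)` of `plan/DAG.tsv` (tex L2339–L2490).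
Nodes the skeleton or the tree ALREADY declares are CITED, not restated:

| node | locator | here | existing declaration (cited) |
|---|---|---|---|
| `Z22:Lem8.2` | p.45 L2339 | `lemma82_iff` | `Skeleton.Lemma82` (DISCHARGED: `Skeleton.lemma82_holds`, tree `Lemma82.lemma_8_2`) |
| `Z22:§8.u025` | p.45 L2340 | `Disp82` | (the display of Lemma 8.2, as a predicate) |
| `Z22:§8.u026` | p.45 L2344 | `frakfW_eq` | `Skeleton.frakfW`, tree `frakf` (`𝓕_{jμ}`) |
| `Z22:Lem8.2.pf` | p.45 L2348 | `Ded82`, `ded82_holds` | edge `lemma82_of_circleMainTerm` uses tree `circleIntegral_lemma82` |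
| `Z22:§8.u027` | p.45 L2349 | `Sum82EqLineIntegral` | |
| `Z22:§8.u028` | p.45 L2353 | `contour82V` (object) | |
| `Z22:§8.u029` | p.45 L2359 | `contour82H` (object) | |
| `Z22:§8.u030` | p.45 L2363 | `Sum82ViaCircle`, `Sum82CircleMainTerm` | |
| `Z22:Lem8.3` | p.46 L2374 | `lemma83_iff` | `Skeleton.Lemma83` |
| `Z22:§8.u031` | p.46 L2375 | `UFormal` (object) | (`𝓤_j(d,r;s)` for `σ > 1`) |
| `Z22:§8.u032` | p.46 L2380 | `UBound`, `UBound.le` | |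
| `Z22:§8.u033` | p.46 L2384 | `UNearOne` | |
| `Z22:§8.u034` | p.46 L2388 | (pointer) | `Skeleton.PiW` (`Π(d,r)`); real-weight form: tree `PiLocal` |
| `Z22:Lem8.4` | p.46 L2392 | `lemma84_iff` | `Skeleton.Lemma84` |
| `Z22:§8.u035` | p.46 L2393 | `Disp84` | |
| `Z22:§8.u036` | p.46 L2397 | `frakgW_eq` | `Skeleton.frakgW`, tree `frakg` (`𝓖_{jμ}`) |
| `Z22:Lem8.4.pf` | p.46 L2401 | `Ded84`, `ded84_holds` | edge `lemma84_of` uses tree `circleIntegral_lemma84` |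
| `Z22:(8.9)` | p.46 L2402 | `Sum84EqLineIntegral` | |
| `Z22:§8.u037` | p.46 L2406 | `XiSeriesFactor`, `xiSeriesFactor_of_eq_uFormal` | |
| `Z22:§8.u038` | p.46 L2410 | `LQuotientOnCircle` | |
| `Z22:§8.u039` | p.47 L2414 | `Integral89MainTerm` | |
| `Z22:§8.u040`–`u043` | p.47 L2421–L2433 | `SumVk1Eval`, `SumVk2Eval`, `SumVk1XiEval`, `SumVk2XiEval` | `Skeleton.vk1`, `vk2`, `xiZero` |
| `Z22:§8.u044` | p.47 L2437 | `SjGathered` | `Skeleton.Sj`, `a11`, `a21`, `lamZero`, `PiW` |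
| `Z22:§8.u045` | p.47 L2444 | `MoebiusLocalFactorIdentity` | real-weight version PROVED: tree `sum_squarefree_divisors_local` |
| `Z22:(8.10)` | p.48 L2448 | `Eq810` | real-weight version PROVED: tree `sum_squarefree_divisors_PiLocal` |
| `Z22:§8.u046` | p.48 L2452 | `SjOverN` | |
| `Z22:§8.u047` | p.48 L2459 | `LamZeroEuler`, `LamZeroApprox` | |
| `Z22:§8.u048` | p.48 L2463 | `AbsChiTotientSum`, `EulerFactorIdentity848` | (manuscript cites [T, 1.2.12]) |
| `Z22:(8.11)` | p.48 L2467 | `Eq811` | right side = tree `S811` at the manuscript's profiles |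
| `Z22:(8.12)` | p.48 L2473 | `Eq812`, edge `eq812_of_eq811`, `P1_div_P2` | tree `S812`, `S811_eq_S812` |
| `Z22:§8.u049`, `u050` | pp.48–49 L2480–L2483 | `ProfileApprox6`, `ProfileApprox7` (`ffW`, `ghW`) | exact main-value versions PROVED: tree `frakf_main_*`, `frakg_main_*` |
| `Z22:(8.13)`, `(8.14)` | p.49 L2487–L2490 | `ff16_eq`, `gh16_eq`, `ff26_eq`, `gh26_eq` | tree `ff16`, `gh16`, `ff26`, `gh26` (`Section8Defs`) |

Glyphs: the source's `\f,\g,\u` are calligraphic (`𝓕_{jμ}`, `𝓖_{jμ}`, `𝓤_j`, rendered "Fjμ, Gjμ,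
Uj" in the PDF), its `\ff,\gh` fraktur (`𝔣_{16}`, `𝔤_{16}`); the skeleton's docstrings write `𝔣_{jμ}`,
`𝔤_{jμ}`, `𝔲_j` for the former — same objects (`Skeleton.frakfW`, `frakgW`).

Conventions (those of the skeleton, `skel/INTERFACE.md` §3): "`D` large" = `Skeleton.ForAllLarge`;
(A) = `Skeleton.AssumptionA D χ` as an antecedent (the manuscript assumes (A) from §5 on, p.28);
"`X = Y + O(E)`" ↦ `∃ C, … ‖X − Y‖ ≤ C·E`; "`+ o(α)`" ↦ `∀ ε > 0, … ≤ ε·α`; `O(ε₁)`,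
`ε₁ = exp{−c𝓛^{1/10}}` (§7 p.40, tex L2128) ↦ `≤ C·exp(−c𝓛^{1/10})` with `∃ c > 0`; the undefined
symbol `α₁` of the source (adjudicated STYLE, read1-12; convention of record `α₁ := α𝓛`,
`skel/GAP-NODE-MAP.md`) ↦ `alpha D * ell D`. `(1/2πi)∫_{(c)}` ↦ `vlineInt c`, `(1/2πi)∫_{|s|=R}` ↦
`circInt R` (Mathlib's `circleIntegral`); `x^s` for real `x > 0` ↦ `(x : ℂ) ^ s`
(`= exp(s log x)`, Mathlib `Complex.cpow_def_of_ne_zero`). Exact identities ((8.9), `Sum82EqLineIntegral`, (8.10), …) are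
typed as plain universal statements (no "`D` large"), under the hypotheses of their context.

Kernel content (0 new facts; every `theorem` is proved): the unfolding/bridge lemmas
`lemma82_iff`, `lemma83_iff`, `lemma84_iff`, `frakfW_eq`, `frakgW_eq`, `ff16_eq`, …; the EDGES
`lemma82_of_circleMainTerm : Sum82CircleMainTerm c′ → Skeleton.Lemma82 c′` and
`lemma84_of : Sum84EqLineIntegral c′ → Integral89MainTerm c′ → Skeleton.Lemma84 c′` ("the result
now follows by direct calculation" = the tree's residue computations `circleIntegral_lemma82/84`),
hence `ded82_holds`, `ded84_holds`; `eq812_of_eq811 : Eq811 c′ → Eq812 c′` (the change of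
variables, tree `S811_eq_S812`); `xiSeriesFactor_of_eq_uFormal` (u037 from the definition of
`𝓤_j` and `L(s,χ) ≠ 0` for `σ > 1`, Mathlib). What is NOT here: the nodes before Lemma 8.2
(Lemma 8.1–(8.8), file `TypedSection08A`) and after (8.14) ((8.15)–(8.24), file `TypedSection08C`);
any discharge of the analytic claims (contour shifts, Lemma 8.3/Appendix A, [T, 1.2.12]).

## References

* Y. Zhang, arXiv:2211.02515v1 (2022), §8 pp. 45–49 (Lemmas 8.2–8.4, (8.9)–(8.14)); §7 p.33
  (`S_j`, `ξ₀ⱼ`, `λ₀ⱼ`), p.40 (`ε₁`); §5 Lemmas 5.5, 5.6 p.28–29; §2 (2.21), (2.31).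
  [cite: Zhang2022LandauSiegel, §8 pp. 45–49]
-/

noncomputable section

open Complex Real ComplexConjugate
open Literature.NumberTheory.LFunctions.Zhang2022.Skeleton

namespace Literature.NumberTheory.LFunctions.Zhang2022.Typed.S8B

/-! ## Integral notation of the source -/

/-- **`(1/2πi)∫_{(c)} F(s) ds`** — the integral up the vertical line `Re s = c`, in the parametrisation
`s = c + it`, `ds = i dt`: `(1/2π)∫_{−∞}^{∞} F(c + it) dt` (Bochner integral over `ℝ`). The
manuscript's `∫_{(1)}` (proof of Lemma 8.2, (8.9)). [cite: Zhang2022LandauSiegel, §8 p.45 (proof of Lemma 8.2)] -/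
def vlineInt (c : ℝ) (F : ℂ → ℂ) : ℂ := (1 / (2 * π) : ℂ) * ∫ t : ℝ, F (c + t * I)

/-- **`(1/2πi)∫_{|s|=R} F(s) ds`** — the integral over the circle `|s| = R` (counter-clockwise;
Mathlib's `circleIntegral` with centre `0`). [cite: Zhang2022LandauSiegel, §8 p.45 (proof of Lemma 8.2)] -/
def circInt (R : ℝ) (F : ℂ → ℂ) : ℂ := (2 * π * I)⁻¹ * ∮ s in C((0 : ℂ), R), F s

section Objects

variable (c' : ℝ) {D : ℕ} [NeZero D] (χ : DirichletCharacter ℂ D)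

/-! ## Lemma 8.2 (`Z22:Lem8.2`, p.45, tex L2339) — banked node `Skeleton.Lemma82 c′` -/

/-- The left side of Lemma 8.2 / of `Z22:§8.u025` [Z22 p.45, tex L2340]:
`Σ_{m<x} χ(m)m^{−(1−β_j)}(x/m)^{β_μ}log(x/m)` — literally the sum inside `Skeleton.Lemma82`
(`m` over `1 ≤ m < x`; `β_j = Skeleton.betaJ` with `β₄ = β₁, β₅ = β₂`, `β_μ = Skeleton.betaMu`,
`μ ∈ {6,7}`). [cite: Zhang2022LandauSiegel, §8 Lemma 8.2 p.45] -/
def sum82 (j μ : ℕ) (x : ℝ) : ℂ :=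
  ∑ m ∈ Finset.Ico 1 ⌈x⌉₊, χ (m : ZMod D) / (m : ℂ) ^ (1 - betaJ c' D j) *
    ((x / m : ℝ) : ℂ) ^ betaMu D μ * (Real.log (x / m) : ℂ)

/-- **`Z22:§8.u025`** [Z22 p.45, tex L2340], the display of Lemma 8.2 as a predicate in
`(j, μ, x)` and the implied constant `C` of `O(𝓛⁻⁶)`:
"`Σ_{m<x} χ(m)m^{−(1−β_j)}(x/m)^{β_μ}log(x/m) = L′(1,χ)𝓕_{jμ}(x) + O(𝓛⁻⁶)`", with
`𝓕_{jμ} = Skeleton.frakfW`. CLAIM (a clause of `Skeleton.Lemma82`, see `lemma82_iff`).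
[cite: Zhang2022LandauSiegel, §8 Lemma 8.2 p.45] -/
def Disp82 (j μ : ℕ) (x : ℝ) (C : ℝ) : Prop :=
  ‖sum82 c' χ j μ x - deriv χ.LFunction 1 * frakfW c' D j μ x‖ ≤ C * (ell D ^ 6)⁻¹

omit [NeZero D] in
/-- **`Z22:§8.u026`** [Z22 p.45, tex L2344]: "`𝓕_{jμ}(x) = (1 + (β_μ − β_j)log x)x^{β_μ}`" — this IS
the banked object `Skeleton.frakfW c′ D j μ x` (tree `frakf`), unfolded verbatim for real `x > 0`.
[cite: Zhang2022LandauSiegel, §8 Lemma 8.2 p.45] -/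
theorem frakfW_eq (j μ : ℕ) {x : ℝ} (hx : 0 < x) :
    frakfW c' D j μ x =
      (1 + (betaMu D μ - betaJ c' D j) * (Real.log x : ℂ)) * (x : ℂ) ^ betaMu D μ := by
  have hxs : ∀ s : ℂ, (x : ℂ) ^ s = cexp (s * (Real.log x : ℂ)) := fun s => by
    rw [Complex.cpow_def_of_ne_zero (Complex.ofReal_ne_zero.mpr hx.ne'), ← Complex.ofReal_log hx.le,
      mul_comm]
  rw [frakfW, frakf, hxs]

/-! ## Proof of Lemma 8.2 (`Z22:Lem8.2.pf`, p.45, tex L2348–L2368) -/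

/-- **`Z22:§8.u027`** [Z22 p.45, tex L2349] (proof of Lemma 8.2, first step): "The sum is equal to
`(1/2πi)∫_{(1)} L(1−β_j+s,χ) x^s ds/(s−β_μ)²`." (Perron's formula for the weight
`(x/m)^{β_μ}log(x/m)`; an absolutely convergent line integral.) Typed as the exact identity under the
hypotheses of Lemma 8.2 (`T < x < P`, `μ ∈ {6,7}`, `1 ≤ j ≤ 3`). CLAIM.
[cite: Zhang2022LandauSiegel, §8 proof of Lemma 8.2 p.45] -/
def Sum82EqLineIntegral : Prop :=
  ∀ (D : ℕ) [NeZero D] (χ : DirichletCharacter ℂ D), ∀ j ∈ ({1, 2, 3} : Finset ℕ),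
    ∀ μ ∈ ({6, 7} : Finset ℕ), ∀ x : ℝ, bigT D < x → x < bigP D →
      sum82 c' χ j μ x = vlineInt 1 fun s =>
        χ.LFunction (1 - betaJ c' D j + s) * (x : ℂ) ^ s / (s - betaMu D μ) ^ 2

omit [NeZero D] in
/-- **`Z22:§8.u028`** [Z22 p.45, tex L2353] (object): the two vertical pieces of the moved contour,
"`s = α + it` with `|t| ≥ D`, `s = −𝓛⁻¹ + it` with `|t| ≤ D`". No claim.
[cite: Zhang2022LandauSiegel, §8 proof of Lemma 8.2 p.45] -/
def contour82V (D : ℕ) : Set ℂ :=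
  {s | (s.re = alpha D ∧ (D : ℝ) ≤ |s.im|) ∨ (s.re = -(ell D)⁻¹ ∧ |s.im| ≤ D)}

omit [NeZero D] in
/-- **`Z22:§8.u029`** [Z22 p.45, tex L2359] (object): "the two connecting horizontal segments
`s = σ ± iD` with `−𝓛⁻¹ ≤ σ ≤ α`" (printed "`s = σ + ± iD`"). No claim.
[cite: Zhang2022LandauSiegel, §8 proof of Lemma 8.2 p.45] -/
def contour82H (D : ℕ) : Set ℂ :=
  {s | (s.im = D ∨ s.im = -(D : ℝ)) ∧ -(ell D)⁻¹ ≤ s.re ∧ s.re ≤ alpha D}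

/-- **`Z22:§8.u030`, first equality** [Z22 p.45, tex L2363]: "It follows by Lemma 5.6 that
`Σ_{m<x} χ(m)m^{−(1−β_j)}(x/m)^{β_μ}log(x/m) = (1/2πi)∫_{|s|=5α} L(1−β_j+s,χ) x^s ds/(s−β_μ)² + O(ε₁)`"
(`ε₁ = exp{−c𝓛^{1/10}}`, §7 p.40; after moving `∫_{(1)}` to `contour82V ∪ contour82H`). CLAIM
(under (A); hypotheses of Lemma 8.2). [cite: Zhang2022LandauSiegel, §8 proof of Lemma 8.2 p.45] -/
def Sum82ViaCircle : Prop :=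
  ∃ c : ℝ, 0 < c ∧ ∃ C : ℝ, ForAllLarge fun D _ χ => AssumptionA D χ →
    ∀ j ∈ ({1, 2, 3} : Finset ℕ), ∀ μ ∈ ({6, 7} : Finset ℕ), ∀ x : ℝ, bigT D < x → x < bigP D →
      ‖sum82 c' χ j μ x - circInt (5 * alpha D) (fun s =>
          χ.LFunction (1 - betaJ c' D j + s) * (x : ℂ) ^ s / (s - betaMu D μ) ^ 2)‖
        ≤ C * Real.exp (-(c * ell D ^ (1 / 10 : ℝ)))

/-- **`Z22:§8.u030`, second equality** [Z22 p.45, tex L2363–L2365]: "… `= L′(1,χ)·(1/2πi)∫_{|s|=5α}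
x^s(s−β_j)(s−β_μ)⁻² ds + O(𝓛⁻⁶)`" (replacing `L(1−β_j+s,χ)` by `L′(1,χ)(s−β_j)` on `|s| = 5α`).
CLAIM (under (A); hypotheses of Lemma 8.2). Lemma 8.2 follows from it "by direct calculation":
`lemma82_of_circleMainTerm`. [cite: Zhang2022LandauSiegel, §8 proof of Lemma 8.2 p.45] -/
def Sum82CircleMainTerm : Prop :=
  ∃ C : ℝ, ForAllLarge fun D _ χ => AssumptionA D χ →
    ∀ j ∈ ({1, 2, 3} : Finset ℕ), ∀ μ ∈ ({6, 7} : Finset ℕ), ∀ x : ℝ, bigT D < x → x < bigP D →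
      ‖sum82 c' χ j μ x - deriv χ.LFunction 1 * circInt (5 * alpha D) (fun s =>
          (x : ℂ) ^ s * (s - betaJ c' D j) / (s - betaMu D μ) ^ 2)‖ ≤ C * (ell D ^ 6)⁻¹

/-- **`Z22:Lem8.2.pf`** [Z22 p.45, tex L2348–L2368]: the manuscript's PROOF of Lemma 8.2 as a named
implication — Perron (`Sum82EqLineIntegral`), the contour shift "by Lemma 5.6" (`Skeleton.Lemma56`
as cited; `Sum82ViaCircle`), `L(1−β_j+s,χ) ↦ L′(1,χ)(s−β_j)` (`Sum82CircleMainTerm`), "direct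
calculation" ⊢ `Skeleton.Lemma82`. CLAIM(proof); PROVED below (`ded82_holds`) since the last step
alone already yields the lemma in the kernel. [cite: Zhang2022LandauSiegel, §8 proof of Lemma 8.2 p.45] -/
def Ded82 : Prop :=
  Lemma56 → Sum82EqLineIntegral c' → Sum82ViaCircle c' → Sum82CircleMainTerm c' → Lemma82 c'

/-! ## Lemma 8.3 (`Z22:Lem8.3`, p.46, tex L2374) — banked node `Skeleton.Lemma83 c′` -/

/-- **`Z22:§8.u031`** [Z22 p.46, tex L2375] (object): the defining expression
"`𝓤_j(d,r;s) := L(s,χ)/(L(s+β_{j+1},χ)L(s+β_{j+2},χ)) · Σ_n χ(n)ξ₀ⱼ(n;d,r)n^{−s}`" on `σ > 1`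
(`Σ_n … = Skeleton.xiSeries`; Lemma 8.3 asserts an analytic continuation `U` of it to `σ > 9/10`,
cf. `Skeleton.Lemma83`, `lemma83_iff`). [cite: Zhang2022LandauSiegel, §8 Lemma 8.3 p.46] -/
def UFormal (j d r : ℕ) (s : ℂ) : ℂ :=
  χ.LFunction s / (χ.LFunction (s + betaJ c' D (j + 1)) * χ.LFunction (s + betaJ c' D (j + 2))) *
    xiSeries c' χ j d r s

omit [NeZero D] in
/-- **`Z22:§8.u032`** [Z22 p.46, tex L2380]: "`|𝓤_j(d,r;s)| < c∏_{q∣dr}(1 + cq^{−σ})` for `σ > 9/10`"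
(one absolute constant `c`, strict `<`, as printed), as a predicate on the continuation `U`.
CLAIM-clause of Lemma 8.3 (`Skeleton.Lemma83` carries the `≤ C∏(1 + Cq^{−σ})` form: `UBound.le`).
[cite: Zhang2022LandauSiegel, §8 Lemma 8.3 p.46] -/
def UBound (U : ℂ → ℂ) (c : ℝ) (d r : ℕ) : Prop :=
  ∀ s : ℂ, 9 / 10 < s.re → ‖U s‖ < c * ∏ q ∈ (d * r).primeFactors, (1 + c * (q : ℝ) ^ (-s.re))

omit [NeZero D] in
/-- The printed strict bound implies the non-strict form used in `Skeleton.Lemma83`.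
[cite: Zhang2022LandauSiegel, §8 Lemma 8.3 p.46] -/
theorem UBound.le {U : ℂ → ℂ} {c : ℝ} {d r : ℕ} (h : UBound U c d r) :
    ∀ s : ℂ, 9 / 10 < s.re → ‖U s‖ ≤ c * ∏ q ∈ (d * r).primeFactors, (1 + c * (q : ℝ) ^ (-s.re)) :=
  fun s hs => (h s hs).le

/-- **`Z22:§8.u033`** [Z22 p.46, tex L2384]: "if `|s − 1| ≤ 5α`, then `𝓤_j(d,r;s) = Π(d,r) + O(𝓛⁻⁸)`"
(`Π(d,r) = Skeleton.PiW χ d r`, `Z22:§8.u034`), as a predicate on `U` and the implied constant.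
CLAIM-clause of Lemma 8.3. [cite: Zhang2022LandauSiegel, §8 Lemma 8.3 p.46] -/
def UNearOne (U : ℂ → ℂ) (C : ℝ) (d r : ℕ) : Prop :=
  ∀ s : ℂ, ‖s - 1‖ ≤ 5 * alpha D → ‖U s - PiW χ d r‖ ≤ C * (ell D ^ 8)⁻¹

/-! ## Lemma 8.4 (`Z22:Lem8.4`, p.46, tex L2392) — banked node `Skeleton.Lemma84 c′` -/

/-- The left side of Lemma 8.4 / of `Z22:§8.u035` [Z22 p.46, tex L2393]:
`Σ_{n<x} χ(n)ξ₀ⱼ(n;d,r)n⁻¹(x/n)^{−β_μ}log(x/n)` — literally the sum inside `Skeleton.Lemma84`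
(`ξ₀ⱼ = Skeleton.xiZero`). [cite: Zhang2022LandauSiegel, §8 Lemma 8.4 p.46] -/
def sum84 (j μ d r : ℕ) (x : ℝ) : ℂ :=
  ∑ n ∈ Finset.Ico 1 ⌈x⌉₊, χ (n : ZMod D) * xiZero c' D j n d r / (n : ℂ) *
    ((x / n : ℝ) : ℂ) ^ (-betaMu D μ) * (Real.log (x / n) : ℂ)

/-- **`Z22:§8.u035`** [Z22 p.46, tex L2393], the display of Lemma 8.4 as a predicate:
"`Σ_{n<x} χ(n)ξ₀ⱼ(n;d,r)n⁻¹(x/n)^{−β_μ}log(x/n) = L′(1,χ)Π(d,r)𝓖_{jμ}(x) + O(𝓛⁻⁶)`"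
(`𝓖_{jμ} = Skeleton.frakgW`, `Π = Skeleton.PiW`). CLAIM (a clause of `Skeleton.Lemma84`, see
`lemma84_iff`). [cite: Zhang2022LandauSiegel, §8 Lemma 8.4 p.46] -/
def Disp84 (j μ d r : ℕ) (x : ℝ) (C : ℝ) : Prop :=
  ‖sum84 c' χ j μ d r x - deriv χ.LFunction 1 * PiW χ d r * frakgW c' D j μ x‖ ≤ C * (ell D ^ 6)⁻¹

omit [NeZero D] in
/-- **`Z22:§8.u036`** [Z22 p.46, tex L2397]: "`𝓖_{jμ}(x) = β_{j+1}β_{j+2}/β_μ²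
+ (1 − β_{j+1}β_{j+2}/β_μ² − (β_{j+1} − β_μ)(β_{j+2} − β_μ)β_μ⁻¹ log x) x^{−β_μ}`" — this IS the
banked object `Skeleton.frakgW c′ D j μ x` (tree `frakg`), unfolded verbatim for real `x > 0`.
[cite: Zhang2022LandauSiegel, §8 Lemma 8.4 p.46] -/
theorem frakgW_eq (j μ : ℕ) {x : ℝ} (hx : 0 < x) :
    frakgW c' D j μ x =
      betaJ c' D (j + 1) * betaJ c' D (j + 2) / betaMu D μ ^ 2 +
        (1 - betaJ c' D (j + 1) * betaJ c' D (j + 2) / betaMu D μ ^ 2 -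
            (betaJ c' D (j + 1) - betaMu D μ) * (betaJ c' D (j + 2) - betaMu D μ) / betaMu D μ *
              (Real.log x : ℂ)) * (x : ℂ) ^ (-betaMu D μ) := by
  have hxs : ∀ s : ℂ, (x : ℂ) ^ s = cexp (s * (Real.log x : ℂ)) := fun s => by
    rw [Complex.cpow_def_of_ne_zero (Complex.ofReal_ne_zero.mpr hx.ne'), ← Complex.ofReal_log hx.le,
      mul_comm]
  rw [frakgW, frakg, hxs]; ring_nf

/-! ## Proof of Lemma 8.4 (`Z22:Lem8.4.pf`, pp.46–47, tex L2401–L2417) -/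

/-- **`Z22:(8.9)`** [Z22 p.46, (8.9), tex L2402] (proof of Lemma 8.4, first step): "The sum is equal
to `(1/2πi)∫_{(1)} (Σ_n χ(n)ξ₀ⱼ(n;d,r)n^{−(1+s)}) x^s ds/(s+β_μ)²` (8.9)" (`Σ_n … = Skeleton.xiSeries`
at `1 + s`). Typed as the exact identity under the hypotheses of Lemma 8.4 (`dr < PT⁻²`, `T < x < P`,
`μ ∈ {6,7}`, `1 ≤ j ≤ 3`). CLAIM; refines the leaf `Skeleton.Lemma84` (edge `lemma84_of`).
[cite: Zhang2022LandauSiegel, §8 (8.9) p.46] -/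
def Sum84EqLineIntegral : Prop :=
  ∀ (D : ℕ) [NeZero D] (χ : DirichletCharacter ℂ D), ∀ j ∈ ({1, 2, 3} : Finset ℕ),
    ∀ μ ∈ ({6, 7} : Finset ℕ), ∀ d r : ℕ, 1 ≤ d → 1 ≤ r → ((d * r : ℕ) : ℝ) < bigP D / bigT D ^ 2 →
      ∀ x : ℝ, bigT D < x → x < bigP D →
        sum84 c' χ j μ d r x = vlineInt 1 fun s =>
          xiSeries c' χ j d r (1 + s) * (x : ℂ) ^ s / (s + betaMu D μ) ^ 2

/-- **`Z22:§8.u037`** [Z22 p.46, tex L2406]: "Recall that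
`Σ_n χ(n)ξ₀ⱼ(n;d,r)n^{−(1+s)} = L(1+s+β_{j+1},χ)L(1+s+β_{j+2},χ)L(1+s,χ)⁻¹ 𝓤_j(d,r,1+s)`", as a
predicate on the function `U = 𝓤_j(d,r;·)` of Lemma 8.3, on `Re(1+s) > 1` where the series converges
(there it is the definition of `𝓤_j` read backwards: `xiSeriesFactor_of_eq_uFormal`). CLAIM.
[cite: Zhang2022LandauSiegel, §8 proof of Lemma 8.4 p.46] -/
def XiSeriesFactor (j d r : ℕ) (U : ℂ → ℂ) : Prop :=
  ∀ s : ℂ, 0 < s.re →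
    xiSeries c' χ j d r (1 + s) =
      χ.LFunction (1 + s + betaJ c' D (j + 1)) * χ.LFunction (1 + s + betaJ c' D (j + 2)) /
          χ.LFunction (1 + s) * U (1 + s)

/-- **`Z22:§8.u038`** [Z22 p.46, tex L2410]: "By Lemma 5.5 and 5.6, for `|s| = 5α` we have
`L(1+s+β_{j+1},χ)L(1+s+β_{j+2},χ)/L(1+s,χ) = L′(1,χ)(s+β_{j+1})(s+β_{j+2})/s + O(𝓛⁻¹⁵)`."
CLAIM (under (A)). [cite: Zhang2022LandauSiegel, §8 proof of Lemma 8.4 p.46] -/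
def LQuotientOnCircle : Prop :=
  ∃ C : ℝ, ForAllLarge fun D _ χ => AssumptionA D χ → ∀ j ∈ ({1, 2, 3} : Finset ℕ), ∀ s : ℂ,
    ‖s‖ = 5 * alpha D →
      ‖χ.LFunction (1 + s + betaJ c' D (j + 1)) * χ.LFunction (1 + s + betaJ c' D (j + 2)) /
            χ.LFunction (1 + s) -
          deriv χ.LFunction 1 * ((s + betaJ c' D (j + 1)) * (s + betaJ c' D (j + 2)) / s)‖
        ≤ C * (ell D ^ 15)⁻¹

/-- **`Z22:§8.u039`** [Z22 p.47, tex L2414]: "Combining these results with Lemma 8.3, we find that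
the integral (8.9) is equal to
`L′(1,χ)Π(d,r)·(1/2πi)∫_{|s|=5α} (s+β_{j+1})(s+β_{j+2})s⁻¹ x^s (s+β_μ)⁻² ds + O(𝓛⁻⁶)`"
(contour moved "in the same way as in the proof of Lemma 8.2"). CLAIM (under (A); hypotheses of
Lemma 8.4). Lemma 8.4 follows "by direct calculation": `lemma84_of`.
[cite: Zhang2022LandauSiegel, §8 proof of Lemma 8.4 p.47] -/
def Integral89MainTerm : Prop :=
  ∃ C : ℝ, ForAllLarge fun D _ χ => AssumptionA D χ →
    ∀ j ∈ ({1, 2, 3} : Finset ℕ), ∀ μ ∈ ({6, 7} : Finset ℕ), ∀ d r : ℕ, 1 ≤ d → 1 ≤ r →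
      ((d * r : ℕ) : ℝ) < bigP D / bigT D ^ 2 → ∀ x : ℝ, bigT D < x → x < bigP D →
        ‖vlineInt 1 (fun s => xiSeries c' χ j d r (1 + s) * (x : ℂ) ^ s / (s + betaMu D μ) ^ 2) -
            deriv χ.LFunction 1 * PiW χ d r * circInt (5 * alpha D) (fun s =>
              (s + betaJ c' D (j + 1)) * (s + betaJ c' D (j + 2)) * (x : ℂ) ^ s /
                (s * (s + betaMu D μ) ^ 2))‖ ≤ C * (ell D ^ 6)⁻¹

/-- **`Z22:Lem8.4.pf`** [Z22 pp.46–47, tex L2401–L2417]: the manuscript's PROOF of Lemma 8.4 as a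
named implication — (8.9), Lemma 8.3 (`Skeleton.Lemma83`, with the factorisation `Z22:§8.u037`),
"By Lemma 5.5 and 5.6" (`LQuotientOnCircle`), the moved contour (`Integral89MainTerm`), "direct
calculation" ⊢ `Skeleton.Lemma84`. CLAIM(proof); PROVED below (`ded84_holds`): the kernel edge
`lemma84_of` needs only (8.9) and `Integral89MainTerm`. [cite: Zhang2022LandauSiegel, §8 proof of Lemma 8.4 pp.46–47] -/
def Ded84 : Prop :=
  Sum84EqLineIntegral c' → Lemma83 c' → LQuotientOnCircle c' → Integral89MainTerm c' → Lemma84 c'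

/-! ## The four `ϰ`-weighted sums (`Z22:§8.u040`–`u043`, p.47, tex L2420–L2436) -/

/-- **`Z22:§8.u040`** [Z22 p.47, tex L2421]: "By Lemma 8.2 with `x = P₁/dr` …
`Σ_m χ(m)ϰ₁(drm)m^{−(1−β_j)} = L′(1,χ)(log P₁)⁻¹𝓕_{j6}(P₁/dr) + O(𝓛⁻¹⁵)` if `dr < P₁/T`"
(`ϰ₁ = Skeleton.vk1`; all `m` — the summand vanishes for `drm ≥ P₁`, the range `m < ⌈PT⁻²⌉ =
Skeleton.Nsupp D` of `Skeleton.Sj` contains them for `D` large). CLAIM (under (A), `1 ≤ j ≤ 3`).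
[cite: Zhang2022LandauSiegel, §8 p.47] -/
def SumVk1Eval : Prop :=
  ∃ C : ℝ, ForAllLarge fun D _ χ => AssumptionA D χ → ∀ j ∈ ({1, 2, 3} : Finset ℕ), ∀ d r : ℕ,
    1 ≤ d → 1 ≤ r → ((d * r : ℕ) : ℝ) < Skeleton.P1 D / bigT D →
      ‖(∑ m ∈ Finset.Ico 1 (Nsupp D),
            χ (m : ZMod D) * vk1 D (d * r * m) / (m : ℂ) ^ (1 - betaJ c' D j)) -
          deriv χ.LFunction 1 / Real.log (Skeleton.P1 D) * frakfW c' D j 6 (Skeleton.P1 D / (d * r : ℕ))‖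
        ≤ C * (ell D ^ 15)⁻¹

/-- **`Z22:§8.u041`** [Z22 p.47, tex L2425]: "… and
`Σ_m χ(m)ϰ₂(drm)m^{−(1−β_j)} = L′(1,χ)(log P₂)⁻¹𝓕_{j7}(P₂/dr) + O(𝓛⁻¹⁵)` if `dr < P₂/T`"
(Lemma 8.2 with `x = P₂/dr`; `ϰ₂ = Skeleton.vk2`). CLAIM (under (A)).
[cite: Zhang2022LandauSiegel, §8 p.47] -/
def SumVk2Eval : Prop :=
  ∃ C : ℝ, ForAllLarge fun D _ χ => AssumptionA D χ → ∀ j ∈ ({1, 2, 3} : Finset ℕ), ∀ d r : ℕ,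
    1 ≤ d → 1 ≤ r → ((d * r : ℕ) : ℝ) < Skeleton.P2 D / bigT D →
      ‖(∑ m ∈ Finset.Ico 1 (Nsupp D),
            χ (m : ZMod D) * vk2 D (d * r * m) / (m : ℂ) ^ (1 - betaJ c' D j)) -
          deriv χ.LFunction 1 / Real.log (Skeleton.P2 D) * frakfW c' D j 7 (Skeleton.P2 D / (d * r : ℕ))‖
        ≤ C * (ell D ^ 15)⁻¹

/-- **`Z22:§8.u042`** [Z22 p.47, tex L2429]: "by Lemma 8.3 [sic; Lemma 8.4] with `x = P₁/dr` …
`Σ_n χ(n)ϰ̄₁(drn)ξ₀ⱼ(n;d,r)n⁻¹ = L′(1,χ)Π(d,r)(log P₁)⁻¹𝓖_{j6}(P₁/dr) + O(𝓛⁻¹⁵)` if `dr < P₁/T`".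
CLAIM (under (A); `dr < PT⁻²` as in Lemma 8.4 is implied by `dr < P₁/T` for `D` large).
[cite: Zhang2022LandauSiegel, §8 p.47] -/
def SumVk1XiEval : Prop :=
  ∃ C : ℝ, ForAllLarge fun D _ χ => AssumptionA D χ → ∀ j ∈ ({1, 2, 3} : Finset ℕ), ∀ d r : ℕ,
    1 ≤ d → 1 ≤ r → ((d * r : ℕ) : ℝ) < Skeleton.P1 D / bigT D →
      ‖(∑ n ∈ Finset.Ico 1 (Nsupp D),
            χ (n : ZMod D) * conj (vk1 D (d * r * n)) * xiZero c' D j n d r / (n : ℂ)) -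
          deriv χ.LFunction 1 * PiW χ d r / Real.log (Skeleton.P1 D) * frakgW c' D j 6 (Skeleton.P1 D / (d * r : ℕ))‖
        ≤ C * (ell D ^ 15)⁻¹

/-- **`Z22:§8.u043`** [Z22 p.47, tex L2433]: "… and
`Σ_n χ(n)ϰ̄₂(drn)ξ₀ⱼ(n;d,r)n⁻¹ = L′(1,χ)Π(d,r)(log P₂)⁻¹𝓖_{j7}(P₂/dr) + O(𝓛⁻¹⁵)` if `dr < P₂/T`".
CLAIM (under (A)). [cite: Zhang2022LandauSiegel, §8 p.47] -/
def SumVk2XiEval : Prop :=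
  ∃ C : ℝ, ForAllLarge fun D _ χ => AssumptionA D χ → ∀ j ∈ ({1, 2, 3} : Finset ℕ), ∀ d r : ℕ,
    1 ≤ d → 1 ≤ r → ((d * r : ℕ) : ℝ) < Skeleton.P2 D / bigT D →
      ‖(∑ n ∈ Finset.Ico 1 (Nsupp D),
            χ (n : ZMod D) * conj (vk2 D (d * r * n)) * xiZero c' D j n d r / (n : ℂ)) -
          deriv χ.LFunction 1 * PiW χ d r / Real.log (Skeleton.P2 D) * frakgW c' D j 7 (Skeleton.P2 D / (d * r : ℕ))‖
        ≤ C * (ell D ^ 15)⁻¹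

/-! ## Gathering: `S_j(𝐚₁₁,𝐚₂₁)` over `dr` (`Z22:§8.u044`), (8.10), over `n` (`Z22:§8.u046`) -/

/-- The weight `|μ(r)χ(dr)|λ₀ⱼ(dr)Π(d,r)/(drφ(r))` of the display `Z22:§8.u044` [Z22 p.47, tex L2437]
(`λ₀ⱼ = Skeleton.lamZero`, `Π = Skeleton.PiW`; `|μ(r)χ(dr)| = |μ(r)|·|χ(dr)|`).
[cite: Zhang2022LandauSiegel, §8 p.47] -/
def wDR (j d r : ℕ) : ℂ :=
  ((ArithmeticFunction.moebius r).natAbs : ℂ) * (‖χ ((d * r : ℕ) : ZMod D)‖ : ℂ) /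
      (((d * r : ℕ) : ℂ) * (Nat.totient r : ℂ)) * lamZero c' D j (d * r) * PiW χ d r

omit [NeZero D] in
/-- The first bracket `𝓕_{j6}(P₁/y)/log P₁ + ι₂𝓕_{j7}(P₂/y)/log P₂` of `Z22:§8.u044`, `u046`, (8.11)
(`ι₂ = 0.94977 − 1.38995i`, (2.26), the tree's `iota2`). [cite: Zhang2022LandauSiegel, §8 p.47] -/
def FBr (D : ℕ) (j : ℕ) (y : ℝ) : ℂ :=
  frakfW c' D j 6 (Skeleton.P1 D / y) / Real.log (Skeleton.P1 D) + iota2 * frakfW c' D j 7 (Skeleton.P2 D / y) / Real.log (Skeleton.P2 D)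

omit [NeZero D] in
/-- The second bracket `𝓖_{j6}(P₁/y)/log P₁ + ῑ₂𝓖_{j7}(P₂/y)/log P₂` of `Z22:§8.u044`, `u046`, (8.11).
[cite: Zhang2022LandauSiegel, §8 p.47] -/
def GBr (D : ℕ) (j : ℕ) (y : ℝ) : ℂ :=
  frakgW c' D j 6 (Skeleton.P1 D / y) / Real.log (Skeleton.P1 D) +
    conj iota2 * frakgW c' D j 7 (Skeleton.P2 D / y) / Real.log (Skeleton.P2 D)

/-- **`Z22:§8.u044`** [Z22 p.47, tex L2437–L2441]: "Gathering these results together we conclude, by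
simple approximation, that
`S_j(𝐚₁₁,𝐚₂₁) = L′(1,χ)² Σ_{dr<P₂} |μ(r)χ(dr)|(drφ(r))⁻¹λ₀ⱼ(dr)Π(d,r)
(𝓕_{j6}(P₁/dr)/log P₁ + ι₂𝓕_{j7}(P₂/dr)/log P₂)(𝓖_{j6}(P₁/dr)/log P₁ + ῑ₂𝓖_{j7}(P₂/dr)/log P₂)
+ L′(1,χ)² Σ_{P₂≤dr<P₁} |μ(r)χ(dr)|(drφ(r))⁻¹λ₀ⱼ(dr)Π(d,r) 𝓕_{j6}(P₁/dr)𝓖_{j6}(P₁/dr)(log P₁)⁻² + o(α)`"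
(`S_j(𝐚₁₁,𝐚₂₁) = Skeleton.Sj c′ D j (a11 χ) (a21 χ)`, (8.8); `d, r ≥ 1` over the support range of
`Skeleton.Sj`). CLAIM (under (A), `1 ≤ j ≤ 3`); refines `Skeleton.Ded823`.
[cite: Zhang2022LandauSiegel, §8 p.47] -/
def SjGathered : Prop :=
  ∀ ε : ℝ, 0 < ε → ForAllLarge fun D _ χ => AssumptionA D χ → ∀ j ∈ ({1, 2, 3} : Finset ℕ),
    ‖Sj c' D j (a11 χ) (a21 χ) -
        (deriv χ.LFunction 1 ^ 2 *
            (∑ d ∈ Finset.Ico 1 (Nsupp D), ∑ r ∈ Finset.Ico 1 (Nsupp D),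
              if ((d * r : ℕ) : ℝ) < Skeleton.P2 D then
                wDR c' χ j d r * FBr c' D j (d * r : ℕ) * GBr c' D j (d * r : ℕ) else 0) +
          deriv χ.LFunction 1 ^ 2 *
            (∑ d ∈ Finset.Ico 1 (Nsupp D), ∑ r ∈ Finset.Ico 1 (Nsupp D),
              if Skeleton.P2 D ≤ ((d * r : ℕ) : ℝ) ∧ ((d * r : ℕ) : ℝ) < Skeleton.P1 D then
                wDR c' χ j d r * (frakfW c' D j 6 (Skeleton.P1 D / (d * r : ℕ)) *
                  frakgW c' D j 6 (Skeleton.P1 D / (d * r : ℕ)) / (Real.log (Skeleton.P1 D) : ℂ) ^ 2) else 0))‖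
      ≤ ε * alpha D

/-- **`Z22:§8.u045`** [Z22 p.47, tex L2444]: "It can be shown, by verifying the case `n = q^k`, that
`Σ_{n=dr} |μ(r)|r⁻¹ ∏_{(q,r)=1, q∣d} (1 − q⁻¹ − χ(q)q⁻¹) = ∏_{q∣n} (1 − χ(q)q⁻¹)`" (for every
`n ≥ 1`; `r` over the divisors of `n`, `d = n/r`). Exact identity, CLAIM as printed (complex `χ`);
its real-weight form is the tree THEOREM `sum_squarefree_divisors_local` (`Section8ArithmeticIdentity`).
[cite: Zhang2022LandauSiegel, §8 p.47] -/
def MoebiusLocalFactorIdentity : Prop :=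
  ∀ (D : ℕ) [NeZero D] (χ : DirichletCharacter ℂ D) (n : ℕ), n ≠ 0 →
    ∑ r ∈ n.divisors, ((ArithmeticFunction.moebius r).natAbs : ℂ) / (r : ℂ) *
        ∏ q ∈ (n / r).primeFactors.filter (fun q => Nat.Coprime q r),
          (1 - (q : ℂ)⁻¹ - χ (q : ZMod D) * (q : ℂ)⁻¹) =
      ∏ q ∈ n.primeFactors, (1 - χ (q : ZMod D) * (q : ℂ)⁻¹)

/-- **`Z22:(8.10)`** [Z22 p.48, (8.10), tex L2448]: "so that `Σ_{n=dr} |μ(r)|φ(r)⁻¹Π(d,r) = n/φ(n)`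
(8.10)" (every `n ≥ 1`; `Π = Skeleton.PiW`). Exact identity, CLAIM as printed; real-weight form is the
tree THEOREM `sum_squarefree_divisors_PiLocal`. [cite: Zhang2022LandauSiegel, §8 (8.10) p.48] -/
def Eq810 : Prop :=
  ∀ (D : ℕ) [NeZero D] (χ : DirichletCharacter ℂ D) (n : ℕ), n ≠ 0 →
    ∑ r ∈ n.divisors, ((ArithmeticFunction.moebius r).natAbs : ℂ) / (Nat.totient r : ℂ) *
        PiW χ (n / r) r = (n : ℂ) / (Nat.totient n : ℂ)

/-- **`Z22:§8.u046`** [Z22 p.48, tex L2452–L2456]: "It follows, by substituting `n = dr`, that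
`S_j(𝐚₁₁,𝐚₂₁) = L′(1,χ)² Σ_{n<P₂} |χ(n)|λ₀ⱼ(n)φ(n)⁻¹ (𝓕_{j6}(P₁/n)/log P₁ + ι₂𝓕_{j7}(P₂/n)/log P₂)
(𝓖_{j6}(P₁/n)/log P₁ + ῑ₂𝓖_{j7}(P₂/n)/log P₂)
+ L′(1,χ)² Σ_{P₂≤n<P₁} |χ(n)|λ₀ⱼ(n)φ(n)⁻¹ 𝓕_{j6}(P₁/n)𝓖_{j6}(P₁/n)(log P₁)⁻² + o(α)`."
CLAIM (under (A)); refines `Skeleton.Ded823`. [cite: Zhang2022LandauSiegel, §8 p.48] -/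
def SjOverN : Prop :=
  ∀ ε : ℝ, 0 < ε → ForAllLarge fun D _ χ => AssumptionA D χ → ∀ j ∈ ({1, 2, 3} : Finset ℕ),
    ‖Sj c' D j (a11 χ) (a21 χ) -
        (deriv χ.LFunction 1 ^ 2 *
            (∑ n ∈ Finset.Ico 1 ⌈Skeleton.P2 D⌉₊, (‖χ (n : ZMod D)‖ : ℂ) * lamZero c' D j n /
              (Nat.totient n : ℂ) * FBr c' D j n * GBr c' D j n) +
          deriv χ.LFunction 1 ^ 2 *
            (∑ n ∈ Finset.Ico ⌈Skeleton.P2 D⌉₊ ⌈Skeleton.P1 D⌉₊, (‖χ (n : ZMod D)‖ : ℂ) * lamZero c' D j n /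
              (Nat.totient n : ℂ) * (frakfW c' D j 6 (Skeleton.P1 D / n) * frakgW c' D j 6 (Skeleton.P1 D / n) /
                (Real.log (Skeleton.P1 D) : ℂ) ^ 2)))‖
      ≤ ε * alpha D

/-! ## The two inputs of the partial summation (`Z22:§8.u047`, `u048`, p.48) -/

/-- **`Z22:§8.u047`, first equality** [Z22 p.48, tex L2459]: "Since for `n < P`,
`λ₀ⱼ(n) = ∏_{q∣n}(1 − q⁻¹)²(1 + O(α log q/q))` …" — an Euler-factor expansion with local errors
`θ(q) ≪ α log q/q` (`λ₀ⱼ = Skeleton.lamZero`; depends on `D` only through the `β`'s). CLAIM.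
[cite: Zhang2022LandauSiegel, §8 p.48] -/
def LamZeroEuler : Prop :=
  ∃ C : ℝ, ForAllLarge fun D _ _ => ∀ j ∈ ({1, 2, 3} : Finset ℕ), ∀ n : ℕ, 1 ≤ n →
    (n : ℝ) < bigP D → ∃ θ : ℕ → ℂ,
      (∀ q ∈ n.primeFactors, ‖θ q‖ ≤ C * alpha D * Real.log q / q) ∧
        lamZero c' D j n = ∏ q ∈ n.primeFactors, (1 - (q : ℂ)⁻¹) ^ 2 * (1 + θ q)

/-- **`Z22:§8.u047`, second equality** [Z22 p.48, tex L2459]: "… `= φ(n)²/n² + O(α₁)`" for `n < P`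
(`α₁` is undefined in the source; convention of record `α₁ := α𝓛`, read1-12 / `skel/GAP-NODE-MAP.md`).
CLAIM. [cite: Zhang2022LandauSiegel, §8 p.48] -/
def LamZeroApprox : Prop :=
  ∃ C : ℝ, ForAllLarge fun D _ _ => ∀ j ∈ ({1, 2, 3} : Finset ℕ), ∀ n : ℕ, 1 ≤ n →
    (n : ℝ) < bigP D →
      ‖lamZero c' D j n - ((Nat.totient n : ℂ) ^ 2 / (n : ℂ) ^ 2)‖ ≤ C * (alpha D * ell D)

omit [NeZero D] in
/-- The sum `Σ_{n<x} |χ(n)|φ(n)n⁻²` of `Z22:§8.u048` [Z22 p.48, tex L2463] (real; `1 ≤ n < x`).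
[cite: Zhang2022LandauSiegel, §8 p.48] -/
def absChiTotientSum (x : ℝ) : ℝ :=
  ∑ n ∈ Finset.Ico 1 ⌈x⌉₊, ‖χ (n : ZMod D)‖ * (Nat.totient n : ℝ) / (n : ℝ) ^ 2

omit [NeZero D] in
/-- The Euler factor `∏_{(q,D)=1} (1 − q⁻²)` of `Z22:§8.u048` (product over the primes not dividing
`D`; absolutely convergent). [cite: Zhang2022LandauSiegel, §8 p.48] -/
def coprimeEulerFactor (D : ℕ) : ℝ :=
  ∏' p : Nat.Primes, if (p : ℕ) ∣ D then (1 : ℝ) else 1 - ((p : ℝ) ^ 2)⁻¹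

/-- **`Z22:§8.u048`, first equality** [Z22 p.48, tex L2463]: "for `x < P`,
`Σ_{n<x} |χ(n)|φ(n)n⁻² = φ(D)D⁻¹(∏_{(q,D)=1}(1 − q⁻²)) log x + O(log 𝓛)` (see [T, 1.2.12])"
(`1 ≤ x`; [T] = Titchmarsh). CLAIM (a classical mean value; the manuscript's citation is to
E. C. Titchmarsh, *The theory of the Riemann zeta-function*, §1.2 (1.2.12) — a plan/FACT-LIST matter,
not a new fact here). [cite: Zhang2022LandauSiegel, §8 p.48] -/
def AbsChiTotientSum : Prop :=
  ∃ C : ℝ, ForAllLarge fun D _ χ => ∀ x : ℝ, 1 ≤ x → x < bigP D →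
    |absChiTotientSum χ x - (Nat.totient D : ℝ) / D * coprimeEulerFactor D * Real.log x|
      ≤ C * Real.log (ell D)

omit [NeZero D] in
/-- **`Z22:§8.u048`, second equality** [Z22 p.48, tex L2463]: "… `= (6/π²)(∏_{q∣D} q/(q+1)) log x
+ O(log 𝓛)`", i.e. the exact Euler-product identity
`φ(D)D⁻¹ ∏_{(q,D)=1}(1 − q⁻²) = (6/π²)∏_{q∣D} q/(q+1)` (`ζ(2) = π²/6`), which makes the constant
the one of `𝔞` (2.31). CLAIM (exact identity). [cite: Zhang2022LandauSiegel, §8 p.48] -/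
def EulerFactorIdentity848 : Prop :=
  ∀ D : ℕ, D ≠ 0 →
    (Nat.totient D : ℝ) / D * coprimeEulerFactor D =
      6 / π ^ 2 * ∏ q ∈ D.primeFactors, (q : ℝ) / (q + 1)

/-! ## (8.11), (8.12): partial summation and the change of variables (p.48, tex L2466–L2479) -/

/-- The exponent `θ₁ = 0.504` of `P₁ = P^{0.504}` (2.21). [cite: Zhang2022LandauSiegel, §2 (2.21)] -/
def theta1 : ℝ := 0.504

omit [NeZero D] in
/-- The exponent `θ₂ = log P₂/log P` of `P₂ = P^{θ₂}` (`P₂ = P^{0.5}T^{−10}`, (2.21), so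
`θ₂ = 0.5 − 10𝓛^{−7.9}`); used to feed `P₁, P₂` to the tree's (8.11)/(8.12) functionals `S811`, `S812`
(`Ppow_theta1`, `Ppow_theta2`). [cite: Zhang2022LandauSiegel, §2 (2.21)] -/
def theta2 (D : ℕ) : ℝ := Real.log (Skeleton.P2 D) / Real.log (bigP D)

omit [NeZero D] in
/-- `P^{θ₁} = P₁` in the tree's notation `Ppow (log P) θ = e^{θ log P}`. [cite: Zhang2022LandauSiegel, §2 (2.21)] -/
theorem Ppow_theta1 (D : ℕ) : Ppow (Real.log (bigP D)) theta1 = Skeleton.P1 D := by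
  rw [Ppow, theta1, Skeleton.P1, bigP, Real.log_exp, Real.exp_mul]

omit [NeZero D] in
/-- `P₂ > 0`. [cite: Zhang2022LandauSiegel, §2 (2.21)] -/
theorem P2_pos (D : ℕ) : 0 < Skeleton.P2 D := by
  unfold Skeleton.P2 bigP bigT
  exact div_pos (Real.rpow_pos_of_pos (Real.exp_pos _) _) (pow_pos (Real.exp_pos _) _)

omit [NeZero D] in
/-- `P^{θ₂} = P₂` (for `D ≥ 3`, so that `log P = 𝓛⁹ ≠ 0`). [cite: Zhang2022LandauSiegel, §2 (2.21)] -/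
theorem Ppow_theta2 (hD : 3 ≤ D) : Ppow (Real.log (bigP D)) (theta2 D) = Skeleton.P2 D := by
  have hP : Real.log (bigP D) ≠ 0 := by
    rw [bigP, Real.log_exp]
    exact (pow_pos (lt_trans zero_lt_one (one_lt_ell hD)) 9).ne'
  have hmul : Real.log (bigP D) * (Real.log (Skeleton.P2 D) / Real.log (bigP D)) = Real.log (Skeleton.P2 D) := by
    field_simp
  rw [Ppow, theta2, hmul, Real.exp_log (P2_pos D)]

omit [NeZero D] in
/-- "since `P₁/P₂ = P^{0.004}T^{10}`" [Z22 p.48, tex L2479] ((2.21): `P₁ = P^{0.504}`,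
`P₂ = P^{0.5}T^{−10}`) — PROVED. [cite: Zhang2022LandauSiegel, §8 (8.12) p.48] -/
theorem P1_div_P2 (D : ℕ) : Skeleton.P1 D / Skeleton.P2 D = bigP D ^ (0.004 : ℝ) * bigT D ^ 10 := by
  have hP : 0 < bigP D := Real.exp_pos _
  have h5 : 0 < bigP D ^ (0.5 : ℝ) := Real.rpow_pos_of_pos hP _
  rw [Skeleton.P1, Skeleton.P2, div_div_eq_mul_div, show (0.504 : ℝ) = 0.004 + 0.5 by norm_num, Real.rpow_add hP,
    div_eq_iff h5.ne']
  ring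

/-- **`Z22:(8.11)`** [Z22 p.48, (8.11), tex L2467]: "(see [T, 1.2.12]), it follows by partial
integration that `S_j(𝐚₁₁,𝐚₂₁) = 𝔞∫₁^{P₂} (𝓕_{j6}(P₁/x)/log P₁ + ι₂𝓕_{j7}(P₂/x)/log P₂)
(𝓖_{j6}(P₁/x)/log P₁ + ῑ₂𝓖_{j7}(P₂/x)/log P₂) dx/x
+ 𝔞(log P₁)⁻²∫_{P₂}^{P₁} 𝓕_{j6}(P₁/x)𝓖_{j6}(P₁/x) dx/x + o(α)` (8.11)" — the right side is `𝔞` times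
the tree's functional `S811` at the profiles `𝓕_{j6}, 𝓕_{j7}, 𝓖_{j6}, 𝓖_{j7}` (`Skeleton.frakfW/gW`)
and `P₁ = P^{θ₁}`, `P₂ = P^{θ₂}` (`Ppow_theta1/2`); `𝔞 = Skeleton.frakA χ` (2.31). CLAIM (under (A),
`1 ≤ j ≤ 3`); refines `Skeleton.Ded823`. [cite: Zhang2022LandauSiegel, §8 (8.11) p.48] -/
def Eq811 : Prop :=
  ∀ ε : ℝ, 0 < ε → ForAllLarge fun D _ χ => AssumptionA D χ → ∀ j ∈ ({1, 2, 3} : Finset ℕ),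
    ‖Sj c' D j (a11 χ) (a21 χ) - (frakA χ : ℂ) *
        S811 (frakfW c' D j 6) (frakfW c' D j 7) (frakgW c' D j 6) (frakgW c' D j 7)
          (Real.log (bigP D)) theta1 (theta2 D)‖ ≤ ε * alpha D

/-- **`Z22:(8.12)`** [Z22 p.48, (8.12), tex L2473–L2479]: "This yields, by the change of variable
`x → P₁/x` or `x → P₂/x`, `S_j(𝐚₁₁,𝐚₂₁) = 𝔞(log P₁)⁻²∫₁^{P₁} 𝓕_{j6}(x)𝓖_{j6}(x) dx/x
+ 𝔞|ι₂|²(log P₂)⁻²∫₁^{P₂} 𝓕_{j7}(x)𝓖_{j7}(x) dx/x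
+ 𝔞ι₂(log P₁ log P₂)⁻¹∫₁^{P₂} 𝓕_{j7}(x)𝓖_{j6}(P^{0.004}T^{10}x) dx/x
+ 𝔞ῑ₂(log P₁ log P₂)⁻¹∫₁^{P₂} 𝓕_{j6}(P^{0.004}T^{10}x)𝓖_{j7}(x) dx/x + o(α)` (8.12), since
`P₁/P₂ = P^{0.004}T^{10}`" — the right side is `𝔞` times the tree's `S812` (which writes the scaling
as `P₁/P₂`; `P1_div_P2`). CLAIM (under (A)); PROVED from (8.11): `eq812_of_eq811`.
[cite: Zhang2022LandauSiegel, §8 (8.12) p.48] -/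
def Eq812 : Prop :=
  ∀ ε : ℝ, 0 < ε → ForAllLarge fun D _ χ => AssumptionA D χ → ∀ j ∈ ({1, 2, 3} : Finset ℕ),
    ‖Sj c' D j (a11 χ) (a21 χ) - (frakA χ : ℂ) *
        S812 (frakfW c' D j 6) (frakfW c' D j 7) (frakgW c' D j 6) (frakgW c' D j 7)
          (Real.log (bigP D)) theta1 (theta2 D)‖ ≤ ε * alpha D

/-! ## `𝓕_{jμ}(P^z) = 𝔣_{jμ}(z) + O(𝓛⁻⁸)` (`Z22:§8.u049`, `u050`) and (8.13)–(8.14) -/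

/-- The table (8.13)–(8.18) of the `𝔣_{jμ}` as a function of `(j, μ)`: the tree's `ff16 … ff37`
(`Section8Defs`); `0` off the table. [cite: Zhang2022LandauSiegel, §8 (8.13)–(8.18) p.49] -/
def ffW : ℕ → ℕ → ℝ → ℂ
  | 1, 6 => ff16
  | 2, 6 => ff26
  | 3, 6 => ff36
  | 1, 7 => ff17
  | 2, 7 => ff27
  | 3, 7 => ff37
  | _, _ => 0

/-- The table (8.13)–(8.18) of the `𝔤_{jμ}`: the tree's `gh16 … gh37`; `0` off the table.
[cite: Zhang2022LandauSiegel, §8 (8.13)–(8.18) p.49] -/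
def ghW : ℕ → ℕ → ℝ → ℂ
  | 1, 6 => gh16
  | 2, 6 => gh26
  | 3, 6 => gh36
  | 1, 7 => gh17
  | 2, 7 => gh27
  | 3, 7 => gh37
  | _, _ => 0

/-- **`Z22:§8.u049`** [Z22 p.48, tex L2480]: "By direct calculation, for `0 ≤ z ≤ 1` we have
`𝓕_{j6}(P^z) = 𝔣_{j6}(z) + O(𝓛⁻⁸)`, `𝓖_{j6}(P^z) = 𝔤_{j6}(z) + O(𝓛⁻⁸)`" (`1 ≤ j ≤ 3`; the exact
identities at the main values of the `β`'s are the tree's `frakf_main_j6`, `frakg_main_j6`, the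
`O(𝓛⁻⁸)` being `β_j − jiα = O(α²𝓛)`). CLAIM. [cite: Zhang2022LandauSiegel, §8 p.48] -/
def ProfileApprox6 : Prop :=
  ∃ C : ℝ, ForAllLarge fun D _ _ => ∀ j ∈ ({1, 2, 3} : Finset ℕ), ∀ z : ℝ, 0 ≤ z → z ≤ 1 →
    ‖frakfW c' D j 6 (bigP D ^ z) - ffW j 6 z‖ ≤ C * (ell D ^ 8)⁻¹ ∧
      ‖frakgW c' D j 6 (bigP D ^ z) - ghW j 6 z‖ ≤ C * (ell D ^ 8)⁻¹

/-- **`Z22:§8.u050`** [Z22 p.49, tex L2483]: "`𝓕_{j7}(P^z) = 𝔣_{j7}(z) + O(𝓛⁻⁸)`,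
`𝓖_{j7}(P^z) = 𝔤_{j7}(z) + O(𝓛⁻⁸)`" (for `0 ≤ z ≤ 1`, `1 ≤ j ≤ 3`). CLAIM.
[cite: Zhang2022LandauSiegel, §8 p.49] -/
def ProfileApprox7 : Prop :=
  ∃ C : ℝ, ForAllLarge fun D _ _ => ∀ j ∈ ({1, 2, 3} : Finset ℕ), ∀ z : ℝ, 0 ≤ z → z ≤ 1 →
    ‖frakfW c' D j 7 (bigP D ^ z) - ffW j 7 z‖ ≤ C * (ell D ^ 8)⁻¹ ∧
      ‖frakgW c' D j 7 (bigP D ^ z) - ghW j 7 z‖ ≤ C * (ell D ^ 8)⁻¹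

end Objects

/-- **`Z22:(8.13)`**, first half [Z22 p.49, (8.13), tex L2487]: "`𝔣₁₆(z) = (1 + (πi/2)z)e^{(3πi/2)z}`"
— the tree's `ff16` (`Section8Defs`, via `ffF (1/2) (3/2)`), unfolded verbatim.
[cite: Zhang2022LandauSiegel, §8 (8.13) p.49] -/
theorem ff16_eq (z : ℝ) : ff16 z = (1 + π * I / 2 * z) * cexp (3 * π * I / 2 * z) := by
  simp only [ff16, ffF]; push_cast; ring_nf

/-- **`Z22:(8.13)`**, second half [Z22 p.49, (8.13), tex L2487]:
"`𝔤₁₆(z) = 8/3 + (−5/3 − (πi/2)z)e^{(−3πi/2)z}`" — the tree's `gh16`, unfolded verbatim.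
[cite: Zhang2022LandauSiegel, §8 (8.13) p.49] -/
theorem gh16_eq (z : ℝ) :
    gh16 z = 8 / 3 + (-5 / 3 - π * I / 2 * z) * cexp (-3 * π * I / 2 * z) := by
  simp only [gh16, ghF]; push_cast; ring_nf

/-- **`Z22:(8.14)`**, first half [Z22 p.49, (8.14), tex L2490]: "`𝔣₂₆(z) = (1 − (πi/2)z)e^{(3πi/2)z}`"
— the tree's `ff26`, unfolded verbatim. [cite: Zhang2022LandauSiegel, §8 (8.14) p.49] -/
theorem ff26_eq (z : ℝ) : ff26 z = (1 - π * I / 2 * z) * cexp (3 * π * I / 2 * z) := by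
  simp only [ff26, ffF]; push_cast; ring_nf

/-- **`Z22:(8.14)`**, second half [Z22 p.49, (8.14), tex L2490]:
"`𝔤₂₆(z) = 4/3 + (−1/3 + (πi/2)z)e^{(−3πi/2)z}`" — the tree's `gh26`, unfolded verbatim.
[cite: Zhang2022LandauSiegel, §8 (8.14) p.49] -/
theorem gh26_eq (z : ℝ) :
    gh26 z = 4 / 3 + (-1 / 3 + π * I / 2 * z) * cexp (-3 * π * I / 2 * z) := by
  simp only [gh26, ghF]; push_cast; ring_nf

/-! ## Bridges to the banked nodes and the kernel edges -/

section Edges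

variable (c' : ℝ)

/-- `Skeleton.Lemma82 c′` IS "there is `C` such that, for `D` large under (A), the display
`Z22:§8.u025` holds for `1 ≤ j ≤ 3`, `μ ∈ {6,7}`, `T < x < P`" (definitional unfolding).
[cite: Zhang2022LandauSiegel, §8 Lemma 8.2 p.45] -/
theorem lemma82_iff : Lemma82 c' ↔ ∃ C : ℝ, ForAllLarge fun D _ χ => AssumptionA D χ →
    ∀ j ∈ ({1, 2, 3} : Finset ℕ), ∀ μ ∈ ({6, 7} : Finset ℕ), ∀ x : ℝ, bigT D < x → x < bigP D →
      Disp82 c' χ j μ x C :=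
  Iff.rfl

/-- `Skeleton.Lemma83 c′` IS "for `D` large under (A), for `1 ≤ j ≤ 3` and `dr < PT⁻²` there is an
analytic `U` on `σ > 9/10` agreeing with `UFormal` (`Z22:§8.u031`) on `σ > 1`, bounded as in
`Skeleton.Lemma83` (the `≤`-form of `Z22:§8.u032`) and with `UNearOne` (`Z22:§8.u033`)"
(definitional unfolding). [cite: Zhang2022LandauSiegel, §8 Lemma 8.3 p.46] -/
theorem lemma83_iff : Lemma83 c' ↔ ∃ C : ℝ, ForAllLarge fun D _ χ => AssumptionA D χ →
    ∀ j ∈ ({1, 2, 3} : Finset ℕ), ∀ d r : ℕ, 1 ≤ d → 1 ≤ r → ((d * r : ℕ) : ℝ) < bigP D / bigT D ^ 2 →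
      ∃ U : ℂ → ℂ, DifferentiableOn ℂ U {s : ℂ | 9 / 10 < s.re} ∧
        (∀ s : ℂ, 1 < s.re → U s = UFormal c' χ j d r s) ∧
        (∀ s : ℂ, 9 / 10 < s.re →
          ‖U s‖ ≤ C * ∏ q ∈ (d * r).primeFactors, (1 + C * (q : ℝ) ^ (-s.re))) ∧
        UNearOne χ U C d r :=
  Iff.rfl

/-- `Skeleton.Lemma84 c′` IS "there is `C` such that, for `D` large under (A), the display
`Z22:§8.u035` holds for `1 ≤ j ≤ 3`, `μ ∈ {6,7}`, `dr < PT⁻²`, `T < x < P`" (definitional unfolding).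
[cite: Zhang2022LandauSiegel, §8 Lemma 8.4 p.46] -/
theorem lemma84_iff : Lemma84 c' ↔ ∃ C : ℝ, ForAllLarge fun D _ χ => AssumptionA D χ →
    ∀ j ∈ ({1, 2, 3} : Finset ℕ), ∀ μ ∈ ({6, 7} : Finset ℕ), ∀ d r : ℕ, 1 ≤ d → 1 ≤ r →
      ((d * r : ℕ) : ℝ) < bigP D / bigT D ^ 2 → ∀ x : ℝ, bigT D < x → x < bigP D →
        Disp84 c' χ j μ d r x C :=
  Iff.rfl

/-- `Re β_j = 0`: the shifts are purely imaginary ((2.13)). [cite: Zhang2022LandauSiegel, §2 (2.13)] -/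
theorem betaJ_re (D : ℕ) (j : ℕ) : (betaJ c' D j).re = 0 := by
  unfold betaJ beta1 beta2 beta3
  split_ifs <;> simp

/-- `Z22:§8.u037` holds for the function `U` of Lemma 8.3: on `σ > 1` the factorisation is the
definition of `𝓤_j` read backwards, `L(s,χ) ≠ 0` there (Mathlib `LFunction_ne_zero_of_one_le_re`).
PROVED. [cite: Zhang2022LandauSiegel, §8 proof of Lemma 8.4 p.46] -/
theorem xiSeriesFactor_of_eq_uFormal {D : ℕ} [NeZero D] (χ : DirichletCharacter ℂ D) (j d r : ℕ)
    {U : ℂ → ℂ} (hU : ∀ s : ℂ, 1 < s.re → U s = UFormal c' χ j d r s) :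
    XiSeriesFactor c' χ j d r U := by
  intro s hs
  have h1 : 1 < (1 + s).re := by simpa using hs
  have hne : ∀ w : ℂ, 1 < w.re → χ.LFunction w ≠ 0 := fun w hw =>
    DirichletCharacter.LFunction_ne_zero_of_one_le_re χ (Or.inr (by
      intro h; rw [h] at hw; simp at hw)) hw.le
  have hL0 : χ.LFunction (1 + s) ≠ 0 := hne _ h1
  have hL1 : χ.LFunction (1 + s + betaJ c' D (j + 1)) ≠ 0 :=
    hne _ (by rw [Complex.add_re, betaJ_re]; simpa using h1)
  have hL2 : χ.LFunction (1 + s + betaJ c' D (j + 2)) ≠ 0 :=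
    hne _ (by rw [Complex.add_re, betaJ_re]; simpa using h1)
  rw [hU _ h1, UFormal]
  field_simp

/-- `|β_μ| < 5α` (`|β₆| = 3α/2`, `|β₇| = 5α/2`, `α > 0`): `β_μ` lies inside the circle `|s| = 5α`.
[cite: Zhang2022LandauSiegel, §2 (2.22)] -/
theorem norm_betaMu_lt {D : ℕ} (hα : 0 < alpha D) (μ : ℕ) : ‖betaMu D μ‖ < 5 * alpha D := by
  unfold betaMu beta6 beta7
  split_ifs <;> simp [Complex.norm_real, abs_of_pos hα] <;> linarith

/-- `β_μ ≠ 0` (`α > 0`). [cite: Zhang2022LandauSiegel, §2 (2.22)] -/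
theorem betaMu_ne_zero {D : ℕ} (hα : 0 < alpha D) (μ : ℕ) : betaMu D μ ≠ 0 := by
  unfold betaMu beta6 beta7
  split_ifs <;> simp [Complex.I_ne_zero, hα.ne']

/-- **EDGE** (the "direct calculation" of Lemma 8.2, kernel-checked): `Z22:§8.u030` (second
equality) ⟹ `Skeleton.Lemma82`, by the tree's residue computation `circleIntegral_lemma82`
(`(2πi)⁻¹∮_{|s|=5α} x^s(s−β_j)(s−β_μ)⁻² ds = 𝓕_{jμ}(x)`, `|β_μ| < 5α`). PROVED.
[cite: Zhang2022LandauSiegel, §8 proof of Lemma 8.2 p.45] -/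
theorem lemma82_of_circleMainTerm (h : Sum82CircleMainTerm c') : Lemma82 c' := by
  obtain ⟨C, D₀, hD⟩ := h
  refine ⟨C, max D₀ 3, fun D _ χ hDle hq hp hA j hj μ hμ x hTx hxP => ?_⟩
  have hD3 : 3 ≤ D := le_trans (le_max_right _ _) hDle
  have hα : 0 < alpha D := alpha_pos hD3
  have hx : 0 < x := lt_trans (by unfold bigT; positivity) hTx
  have hxs : ∀ s : ℂ, (x : ℂ) ^ s = cexp (s * (Real.log x : ℂ)) := fun s => by
    rw [Complex.cpow_def_of_ne_zero (Complex.ofReal_ne_zero.mpr hx.ne'), ← Complex.ofReal_log hx.le,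
      mul_comm]
  have key := hD D χ (le_trans (le_max_left _ _) hDle) hq hp hA j hj μ hμ x hTx hxP
  have hcirc : circInt (5 * alpha D) (fun s =>
      (x : ℂ) ^ s * (s - betaJ c' D j) / (s - betaMu D μ) ^ 2) = frakfW c' D j μ x := by
    simp only [circInt, hxs, frakfW]
    exact circleIntegral_lemma82 _ _ _ (by
      rw [Metric.mem_ball, dist_zero_right]; exact norm_betaMu_lt hα μ)
  change ‖sum82 c' χ j μ x - deriv χ.LFunction 1 * frakfW c' D j μ x‖ ≤ C * (ell D ^ 6)⁻¹
  rw [← hcirc]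
  exact key

/-- **`Z22:Lem8.2.pf` HOLDS** (for every `c′`): the manuscript's proof-implication `Ded82` is a
theorem of the kernel, via `lemma82_of_circleMainTerm` (independently, `Skeleton.lemma82_holds`
proves Lemma 8.2 itself for `c′ ≥ 0`). [cite: Zhang2022LandauSiegel, §8 proof of Lemma 8.2 p.45] -/
theorem ded82_holds : Ded82 c' := fun _ _ _ h => lemma82_of_circleMainTerm c' h

/-- `Ded82` — `_holds` alias of `ded82_holds` above under the fact's exact name (appended
2026-08-28, D-0026 bookkeeping: the proof term is the existing theorem of this file; no statement,
definition or attribute is edited; no new named fact; the ledger's debt table listed the fact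
unproved). [cite: Zhang2022LandauSiegel, §8 proof of Lemma 8.2 p.45] -/
theorem _root_.Literature.NumberTheory.LFunctions.Zhang2022.Typed.S8B.Ded82_holds : Ded82 c' :=
  _root_.Literature.NumberTheory.LFunctions.Zhang2022.Typed.S8B.ded82_holds (c' := c')

/-- **EDGE** (the "direct calculation" of Lemma 8.4, kernel-checked): (8.9) and `Z22:§8.u039`
⟹ `Skeleton.Lemma84`, by the tree's residue computation `circleIntegral_lemma84`
(`(2πi)⁻¹∮_{|s|=5α} (s+β_{j+1})(s+β_{j+2})x^s s⁻¹(s+β_μ)⁻² ds = 𝓖_{jμ}(x)`; `0`, `−β_μ` inside the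
circle, `β_μ ≠ 0`). PROVED. [cite: Zhang2022LandauSiegel, §8 proof of Lemma 8.4 p.47] -/
theorem lemma84_of (h89 : Sum84EqLineIntegral c') (h839 : Integral89MainTerm c') : Lemma84 c' := by
  obtain ⟨C, D₀, hD⟩ := h839
  refine ⟨C, max D₀ 3, fun D _ χ hDle hq hp hA j hj μ hμ d r hd hr hdr x hTx hxP => ?_⟩
  have hD3 : 3 ≤ D := le_trans (le_max_right _ _) hDle
  have hα : 0 < alpha D := alpha_pos hD3
  have hx : 0 < x := lt_trans (by unfold bigT; positivity) hTx
  have hxs : ∀ s : ℂ, (x : ℂ) ^ s = cexp (s * (Real.log x : ℂ)) := fun s => by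
    rw [Complex.cpow_def_of_ne_zero (Complex.ofReal_ne_zero.mpr hx.ne'), ← Complex.ofReal_log hx.le,
      mul_comm]
  have key := hD D χ (le_trans (le_max_left _ _) hDle) hq hp hA j hj μ hμ d r hd hr hdr x hTx hxP
  have hcirc : circInt (5 * alpha D) (fun s =>
      (s + betaJ c' D (j + 1)) * (s + betaJ c' D (j + 2)) * (x : ℂ) ^ s /
        (s * (s + betaMu D μ) ^ 2)) = frakgW c' D j μ x := by
    simp only [circInt, hxs, frakgW]
    refine circleIntegral_lemma84 _ _ _ _ (Metric.mem_ball_self (mul_pos (by norm_num) hα)) ?_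
      (betaMu_ne_zero hα μ)
    rw [Metric.mem_ball, dist_zero_right, norm_neg]; exact norm_betaMu_lt hα μ
  change ‖sum84 c' χ j μ d r x - deriv χ.LFunction 1 * PiW χ d r * frakgW c' D j μ x‖ ≤
    C * (ell D ^ 6)⁻¹
  rw [h89 D χ j hj μ hμ d r hd hr hdr x hTx hxP, ← hcirc]
  exact key

/-- **`Z22:Lem8.4.pf` HOLDS** (for every `c′`): the proof-implication `Ded84` is a theorem of the
kernel (`lemma84_of`; the inputs Lemma 8.3 and `Z22:§8.u038` enter only through `Z22:§8.u039`).
[cite: Zhang2022LandauSiegel, §8 proof of Lemma 8.4 pp.46–47] -/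
theorem ded84_holds : Ded84 c' := fun h89 _ _ h839 => lemma84_of c' h89 h839

/-- `Ded84` — `_holds` alias of `ded84_holds` above under the fact's exact name (appended
2026-08-28, D-0026 bookkeeping: the proof term is the existing theorem of this file; no statement,
definition or attribute is edited; no new named fact; the ledger's debt table listed the fact
unproved). [cite: Zhang2022LandauSiegel, §8 proof of Lemma 8.4 pp.46–47] -/
theorem _root_.Literature.NumberTheory.LFunctions.Zhang2022.Typed.S8B.Ded84_holds : Ded84 c' :=
  _root_.Literature.NumberTheory.LFunctions.Zhang2022.Typed.S8B.ded84_holds (c' := c')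

/-- `𝓕_{jμ}` is continuous on `(0,∞)`. [cite: Zhang2022LandauSiegel, §8 Lemma 8.2 p.45] -/
theorem continuousOn_frakfW (D : ℕ) (j μ : ℕ) : ContinuousOn (frakfW c' D j μ) (Set.Ioi 0) := by
  have hc : Continuous fun L : ℂ => frakf (betaJ c' D j) (betaMu D μ) L := by
    unfold frakf; fun_prop
  exact hc.comp_continuousOn continuousOn_ofReal_log

/-- `𝓖_{jμ}` is continuous on `(0,∞)`. [cite: Zhang2022LandauSiegel, §8 Lemma 8.4 p.46] -/
theorem continuousOn_frakgW (D : ℕ) (j μ : ℕ) : ContinuousOn (frakgW c' D j μ) (Set.Ioi 0) := by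
  have hc : Continuous fun L : ℂ =>
      frakg (betaJ c' D (j + 1)) (betaJ c' D (j + 2)) (betaMu D μ) L := by
    unfold frakg; fun_prop
  exact hc.comp_continuousOn continuousOn_ofReal_log

/-- **EDGE (8.11) ⟹ (8.12)** ("This yields, by the change of variable `x → P₁/x` or `x → P₂/x`"),
kernel-checked by the tree's `S811_eq_S812` (valid for any profiles continuous on `(0,∞)`). PROVED.
[cite: Zhang2022LandauSiegel, §8 (8.11)–(8.12) p.48] -/
theorem eq812_of_eq811 (h : Eq811 c') : Eq812 c' := by
  intro ε hε
  obtain ⟨D₀, hD⟩ := h ε hε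
  refine ⟨D₀, fun D _ χ hDle hq hp hA j hj => ?_⟩
  have key := hD D χ hDle hq hp hA j hj
  rwa [S811_eq_S812 (continuousOn_frakfW c' D j 6) (continuousOn_frakfW c' D j 7)
    (continuousOn_frakgW c' D j 6) (continuousOn_frakgW c' D j 7)] at key

end Edges

/-! ## Wave 2 (theorem-only append; block F7 of the L2 DISCHARGE LEDGER): `Z22:§8.u037` -/

section Wave2

variable (c' : ℝ)

/-- **`Z22:§8.u037` HOLDS as printed**: with `𝓤_j(d,r;·)` read as its defining expression
(`UFormal`, `Z22:§8.u031`), the factorisation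
`Σ_n χ(n)ξ₀ⱼ(n;d,r)n^{−(1+s)} = L(1+s+β_{j+1},χ)L(1+s+β_{j+2},χ)L(1+s,χ)⁻¹𝓤_j(d,r,1+s)` holds on
`Re(1+s) > 1` for every `χ, j, d, r` (`L ≠ 0` there). DISCHARGED (unconditional; kernel).
[cite: Zhang2022LandauSiegel, §8 proof of Lemma 8.4 p.46, tex L2406] -/
theorem xiSeriesFactor_uFormal {D : ℕ} [NeZero D] (χ : DirichletCharacter ℂ D) (j d r : ℕ) :
    XiSeriesFactor c' χ j d r (UFormal c' χ j d r) :=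
  xiSeriesFactor_of_eq_uFormal c' χ j d r (fun _ _ => rfl)

/-- Lemma 8.3 packaged with `Z22:§8.u037`: the continuation `U` of `Skeleton.Lemma83` satisfies the
factorisation `XiSeriesFactor` (on `σ > 1`), the majorant on `σ > 9/10`, and `UNearOne`
(`Z22:§8.u033`) — the form consumed by "Combining these results with Lemma 8.3" (`Z22:§8.u039`).
PROVED from `Skeleton.Lemma83` alone. [cite: Zhang2022LandauSiegel, §8 Lemma 8.3 p.46, proof of Lemma 8.4 p.47] -/
theorem lemma83_with_factor (h : Lemma83 c') : ∃ C : ℝ, ForAllLarge fun D _ χ => AssumptionA D χ →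
    ∀ j ∈ ({1, 2, 3} : Finset ℕ), ∀ d r : ℕ, 1 ≤ d → 1 ≤ r → ((d * r : ℕ) : ℝ) < bigP D / bigT D ^ 2 →
      ∃ U : ℂ → ℂ, DifferentiableOn ℂ U {s : ℂ | 9 / 10 < s.re} ∧
        XiSeriesFactor c' χ j d r U ∧
        (∀ s : ℂ, 9 / 10 < s.re →
          ‖U s‖ ≤ C * ∏ q ∈ (d * r).primeFactors, (1 + C * (q : ℝ) ^ (-s.re))) ∧
        UNearOne χ U C d r := by
  obtain ⟨C, D₀, hD⟩ := h
  refine ⟨C, D₀, fun D _ χ hDle hq hp hA j hj d r hd hr hdr => ?_⟩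
  obtain ⟨U, hU1, hU2, hU3, hU4⟩ := hD D χ hDle hq hp hA j hj d r hd hr hdr
  exact ⟨U, hU1, xiSeriesFactor_of_eq_uFormal c' χ j d r hU2, hU3, hU4⟩

end Wave2

/-! ## Bridges: the supplementary row-8 / (8.13)–(8.14) typings ↔ the decls OF RECORD
(L2-t8 `Section8cStatements`, L2-t9 `Section8dStatements`; RE-POINT L2-t6 → (a), 2026-08-26T00:07Z)

Each supplementary `def` of this file that types a node owned by another row is here certified
against the decl of record: definitionally equal (`Iff.rfl`) or equivalent for `D` large (the (8.11)/
(8.12) scale parametrisations differ only in how `P₁, P₂` are fed to the tree's `S811/S812`), or —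
where this file typed the display in greater generality (every Dirichlet character `χ`, `|μ(r)|`
weights over all divisors) — shown to IMPLY the decl of record. Theorem-only; 0 new definitions.
-/

section Bridges

variable (c' : ℝ)

/-- `Z22:§8.u040`: supplementary `SumVk1Eval` IS `Section8cStatements.Step8u040` (definitionally).
[cite: Zhang2022LandauSiegel, §8 p.47, tex L2421] -/
theorem sumVk1Eval_iff : SumVk1Eval c' ↔ Section8cStatements.Step8u040 c' := Iff.rfl

/-- `Z22:§8.u041`: `SumVk2Eval` IS `Section8cStatements.Step8u041`. [cite: Zhang2022LandauSiegel, §8 p.47, tex L2425] -/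
theorem sumVk2Eval_iff : SumVk2Eval c' ↔ Section8cStatements.Step8u041 c' := Iff.rfl

/-- `Z22:§8.u042`: `SumVk1XiEval` IS `Section8cStatements.Step8u042`. [cite: Zhang2022LandauSiegel, §8 p.47, tex L2429] -/
theorem sumVk1XiEval_iff : SumVk1XiEval c' ↔ Section8cStatements.Step8u042 c' := Iff.rfl

/-- `Z22:§8.u043`: `SumVk2XiEval` IS `Section8cStatements.Step8u043`. [cite: Zhang2022LandauSiegel, §8 p.47, tex L2433] -/
theorem sumVk2XiEval_iff : SumVk2XiEval c' ↔ Section8cStatements.Step8u043 c' := Iff.rfl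

/-- `Z22:§8.u044` objects: `wDR = arithW`, `FBr = mFac`, `GBr = nFac` (definitionally).
[cite: Zhang2022LandauSiegel, §8 p.47, tex L2437] -/
theorem wDR_eq_arithW {D : ℕ} [NeZero D] (χ : DirichletCharacter ℂ D) (j d r : ℕ) :
    wDR c' χ j d r = Section8cStatements.arithW c' χ j d r := rfl

/-- `FBr = Section8cStatements.mFac`. [cite: Zhang2022LandauSiegel, §8 (8.11) p.48, tex L2467] -/
theorem FBr_eq_mFac (D : ℕ) (j : ℕ) (y : ℝ) : FBr c' D j y = Section8cStatements.mFac c' D j y := rfl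

/-- `GBr = Section8cStatements.nFac`. [cite: Zhang2022LandauSiegel, §8 (8.11) p.48, tex L2467] -/
theorem GBr_eq_nFac (D : ℕ) (j : ℕ) (y : ℝ) : GBr c' D j y = Section8cStatements.nFac c' D j y := rfl

/-- `|μ(r)|` is the indicator of the squarefree `r`: a divisor sum weighted by `|μ(r)|` equals the sum
over the squarefree divisors (the reading of "`Σ_{n=dr} |μ(r)| …`" in the decls of record).
[cite: Zhang2022LandauSiegel, §8 (8.10) p.48] -/
theorem sum_divisors_moebius_natAbs_mul {n : ℕ} (f : ℕ → ℂ) :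
    ∑ r ∈ n.divisors, ((ArithmeticFunction.moebius r).natAbs : ℂ) * f r =
      ∑ r ∈ n.divisors with Squarefree r, f r := by
  rw [Finset.sum_filter]
  refine Finset.sum_congr rfl (fun r _ => ?_)
  split_ifs with hsq
  · have h1 : (ArithmeticFunction.moebius r).natAbs = 1 := by
      have h := ArithmeticFunction.abs_moebius_eq_one_of_squarefree hsq
      rw [Int.abs_eq_natAbs] at h
      exact_mod_cast h
    rw [h1]; simp
  · rw [ArithmeticFunction.moebius_eq_zero_of_not_squarefree hsq]; simp

/-- `Z22:§8.u045`: the supplementary `MoebiusLocalFactorIdentity` (every `χ`, `|μ(r)|`-weights over all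
divisors) IMPLIES the decl of record `Section8cStatements.Step8u045` (quadratic `χ`, squarefree `r`).
[cite: Zhang2022LandauSiegel, §8 p.47, tex L2444] -/
theorem step8u045_of_moebiusLocalFactorIdentity (h : MoebiusLocalFactorIdentity) :
    Section8cStatements.Step8u045 := by
  intro D _ χ _ n hn
  have key := h D χ n hn
  rw [← sum_divisors_moebius_natAbs_mul]
  rw [← key]
  exact Finset.sum_congr rfl (fun r _ => by ring)

/-- `Z22:(8.10)`: the supplementary `Eq810` (every `χ`, `|μ(r)|`-weights over all divisors) IMPLIES the
decl of record `Section8cStatements.Eq810` (quadratic `χ`, squarefree `r`); the converse is not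
claimed (the supplementary typing is the more general statement). [cite: Zhang2022LandauSiegel, §8 (8.10) p.48] -/
theorem eq810_ofRecord_of_eq810 (h : Eq810) : Section8cStatements.Eq810 := by
  intro D _ χ _ n hn
  have key := h D χ n hn
  rw [← sum_divisors_moebius_natAbs_mul]
  rw [← key]
  exact Finset.sum_congr rfl (fun r _ => by ring)

/-- `Z22:§8.u046`: supplementary `SjOverN` ↔ decl of record `Section8cStatements.Step8u046` (same
display; the factors `𝓕…·𝓖…` are grouped as `mFac·nFac`, `diagFac` there). [cite: Zhang2022LandauSiegel, §8 p.48, tex L2452] -/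
theorem sjOverN_iff : SjOverN c' ↔ Section8cStatements.Step8u046 c' := by
  have hterm : ∀ (D : ℕ) [NeZero D] (χ : DirichletCharacter ℂ D) (j : ℕ),
      (deriv χ.LFunction 1 ^ 2 *
            (∑ n ∈ Finset.Ico 1 ⌈Skeleton.P2 D⌉₊, (‖χ (n : ZMod D)‖ : ℂ) * lamZero c' D j n /
              (Nat.totient n : ℂ) * FBr c' D j n * GBr c' D j n) +
          deriv χ.LFunction 1 ^ 2 *
            (∑ n ∈ Finset.Ico ⌈Skeleton.P2 D⌉₊ ⌈Skeleton.P1 D⌉₊, (‖χ (n : ZMod D)‖ : ℂ) *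
              lamZero c' D j n / (Nat.totient n : ℂ) * (frakfW c' D j 6 (Skeleton.P1 D / n) *
                frakgW c' D j 6 (Skeleton.P1 D / n) / (Real.log (Skeleton.P1 D) : ℂ) ^ 2))) =
        (deriv χ.LFunction 1 ^ 2 *
            (∑ n ∈ Finset.Ico 1 ⌈Skeleton.P2 D⌉₊,
              (‖χ (n : ZMod D)‖ : ℂ) * lamZero c' D j n / (Nat.totient n : ℂ) *
                (Section8cStatements.mFac c' D j n * Section8cStatements.nFac c' D j n)) +
          deriv χ.LFunction 1 ^ 2 *
            (∑ n ∈ Finset.Ico ⌈Skeleton.P2 D⌉₊ ⌈Skeleton.P1 D⌉₊,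
              (‖χ (n : ZMod D)‖ : ℂ) * lamZero c' D j n / (Nat.totient n : ℂ) *
                Section8cStatements.diagFac c' D j n)) := by
    intro D _ χ j
    congr 2
    exact Finset.sum_congr rfl (fun n _ => by rw [FBr_eq_mFac, GBr_eq_nFac]; ring)
  constructor
  · intro h ε hε
    obtain ⟨D₀, hD⟩ := h ε hε
    refine ⟨D₀, fun D _ χ hDle hq hp hA j hj => ?_⟩
    have key := hD D χ hDle hq hp hA j hj
    rwa [hterm D χ j] at key
  · intro h ε hε
    obtain ⟨D₀, hD⟩ := h ε hε
    refine ⟨D₀, fun D _ χ hDle hq hp hA j hj => ?_⟩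
    have key := hD D χ hDle hq hp hA j hj
    rwa [← hterm D χ j] at key

/-- `Z22:§8.u047` (second equality): supplementary `LamZeroApprox` ↔ decl of record
`Section8cStatements.Step8u047` (`φ(n)²/n²` written `(φ(n)/n)²` there). [cite: Zhang2022LandauSiegel, §8 p.48, tex L2459] -/
theorem lamZeroApprox_iff : LamZeroApprox c' ↔ Section8cStatements.Step8u047 c' := by
  have hterm : ∀ n : ℕ, ((Nat.totient n : ℂ) ^ 2 / (n : ℂ) ^ 2) = ((Nat.totient n : ℂ) / (n : ℂ)) ^ 2 :=
    fun n => by rw [div_pow]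
  constructor
  · rintro ⟨C, D₀, hD⟩
    refine ⟨C, D₀, fun D _ χ hDle hq hp j hj n hn hnP => ?_⟩
    have key := hD D χ hDle hq hp j hj n hn hnP
    rwa [hterm n] at key
  · rintro ⟨C, D₀, hD⟩
    refine ⟨C, D₀, fun D _ χ hDle hq hp j hj n hn hnP => ?_⟩
    have key := hD D χ hDle hq hp j hj n hn hnP
    rwa [← hterm n] at key

/-- `Z22:§8.u048` (the constant): supplementary `EulerFactorIdentity848` IS the decl of record
`Section8cStatements.Step8u048const` (definitionally; `coprimeEulerFactor` unfolds to the same `tprod`).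
[cite: Zhang2022LandauSiegel, §8 p.48, tex L2463] -/
theorem eulerFactorIdentity848_iff : EulerFactorIdentity848 ↔ Section8cStatements.Step8u048const :=
  Iff.rfl

/-- `Z22:§8.u048` (the mean value): the supplementary `AbsChiTotientSum` is typed with the FIRST
printed constant `φ(D)D⁻¹∏_{(q,D)=1}(1 − q⁻²)`, the decl of record `Section8cStatements.Step8u048` with
the SECOND, `(6/π²)∏_{q∣D} q/(q+1)`; given the printed identity of the two constants
(`EulerFactorIdentity848` = `Step8u048const`) they are equivalent. [cite: Zhang2022LandauSiegel, §8 p.48, tex L2463] -/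
theorem absChiTotientSum_iff (hc : EulerFactorIdentity848) :
    AbsChiTotientSum ↔ Section8cStatements.Step8u048 := by
  have hconst : ∀ (D : ℕ) [NeZero D], (Nat.totient D : ℝ) / D * coprimeEulerFactor D =
      6 / π ^ 2 * ∏ q ∈ D.primeFactors, (q : ℝ) / (q + 1) :=
    fun D _ => hc D (NeZero.ne D)
  constructor
  · rintro ⟨C, D₀, hD⟩
    refine ⟨C, D₀, fun D _ χ hDle hq hp x hx1 hxP => ?_⟩
    have key := hD D χ hDle hq hp x hx1 hxP
    rwa [absChiTotientSum, hconst D] at key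
  · rintro ⟨C, D₀, hD⟩
    refine ⟨C, D₀, fun D _ χ hDle hq hp x hx1 hxP => ?_⟩
    have key := hD D χ hDle hq hp x hx1 hxP
    rwa [absChiTotientSum, hconst D]

/-- The tree's (8.11)/(8.12) functionals depend on the scale parameters only through `P^{θ₁}, P^{θ₂}`:
this file's parametrisation `(log P, θ₁, θ₂ = log P₂/log P)` and `Section8cStatements`'
`(𝓛⁹, 0.504, 0.5 − 10𝓛^{1.1}/𝓛⁹)` both evaluate them at `P₁, P₂` (`D ≥ 3`).
[cite: Zhang2022LandauSiegel, §8 (8.11) p.48, tex L2467] -/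
theorem S811_params_eq {D : ℕ} (hD : 3 ≤ D) (F6 F7 G6 G7 : ℝ → ℂ) :
    S811 F6 F7 G6 G7 (Real.log (bigP D)) theta1 (theta2 D) =
      S811 F6 F7 G6 G7 (ell D ^ 9) 0.504 (Section8cStatements.theta2 D) := by
  have hL : ell D ≠ 0 := (lt_trans zero_lt_one (one_lt_ell hD)).ne'
  simp only [S811, Ppow_theta1, Ppow_theta2 hD, Section8cStatements.Ppow_theta1,
    Section8cStatements.Ppow_theta2 D hL]

/-- Same for (8.12)'s functional `S812`. [cite: Zhang2022LandauSiegel, §8 (8.12) p.48, tex L2473] -/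
theorem S812_params_eq {D : ℕ} (hD : 3 ≤ D) (F6 F7 G6 G7 : ℝ → ℂ) :
    S812 F6 F7 G6 G7 (Real.log (bigP D)) theta1 (theta2 D) =
      S812 F6 F7 G6 G7 (ell D ^ 9) 0.504 (Section8cStatements.theta2 D) := by
  have hL : ell D ≠ 0 := (lt_trans zero_lt_one (one_lt_ell hD)).ne'
  simp only [S812, Ppow_theta1, Ppow_theta2 hD, Section8cStatements.Ppow_theta1,
    Section8cStatements.Ppow_theta2 D hL]

/-- `Z22:(8.11)`: supplementary `Eq811` ↔ decl of record `Section8cStatements.Eq811` (the two differ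
only in the scale parametrisation of `S811`, equal for `D ≥ 3`; both are eventual statements).
[cite: Zhang2022LandauSiegel, §8 (8.11) p.48, tex L2467] -/
theorem eq811_iff : Eq811 c' ↔ Section8cStatements.Eq811 c' := by
  constructor
  · intro h ε hε
    obtain ⟨D₀, hD⟩ := h ε hε
    refine ⟨max D₀ 3, fun D _ χ hDle hq hp hA j hj => ?_⟩
    have key := hD D χ (le_trans (le_max_left _ _) hDle) hq hp hA j hj
    rwa [S811_params_eq (le_trans (le_max_right _ _) hDle)] at key
  · intro h ε hε
    obtain ⟨D₀, hD⟩ := h ε hε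
    refine ⟨max D₀ 3, fun D _ χ hDle hq hp hA j hj => ?_⟩
    have key := hD D χ (le_trans (le_max_left _ _) hDle) hq hp hA j hj
    rwa [← S811_params_eq (le_trans (le_max_right _ _) hDle)] at key

/-- `Z22:(8.12)`: supplementary `Eq812` ↔ decl of record `Section8cStatements.Eq812`.
[cite: Zhang2022LandauSiegel, §8 (8.12) p.48, tex L2473] -/
theorem eq812_iff : Eq812 c' ↔ Section8cStatements.Eq812 c' := by
  constructor
  · intro h ε hε
    obtain ⟨D₀, hD⟩ := h ε hε
    refine ⟨max D₀ 3, fun D _ χ hDle hq hp hA j hj => ?_⟩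
    have key := hD D χ (le_trans (le_max_left _ _) hDle) hq hp hA j hj
    rwa [S812_params_eq (le_trans (le_max_right _ _) hDle)] at key
  · intro h ε hε
    obtain ⟨D₀, hD⟩ := h ε hε
    refine ⟨max D₀ 3, fun D _ χ hDle hq hp hA j hj => ?_⟩
    have key := hD D χ (le_trans (le_max_left _ _) hDle) hq hp hA j hj
    rwa [← S812_params_eq (le_trans (le_max_right _ _) hDle)] at key

/-- The two dispatch tables of the printed profiles agree on the manuscript's indices:
`ffW j μ = Section8dStatements.ffP j μ` for `j ∈ {1,2,3}`, `μ ∈ {6,7}`. [cite: Zhang2022LandauSiegel, §8 (8.13)–(8.18) p.49] -/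
theorem ffW_eq_ffP : ∀ j ∈ ({1, 2, 3} : Finset ℕ), ∀ μ ∈ ({6, 7} : Finset ℕ),
    ffW j μ = Section8dStatements.ffP j μ := by
  intro j hj μ hμ
  simp only [Finset.mem_insert, Finset.mem_singleton] at hj hμ
  rcases hj with rfl | rfl | rfl <;> rcases hμ with rfl | rfl <;> simp [ffW, Section8dStatements.ffP]

/-- `ghW j μ = Section8dStatements.ghP j μ` for `j ∈ {1,2,3}`, `μ ∈ {6,7}`. [cite: Zhang2022LandauSiegel, §8 (8.13)–(8.18) p.49] -/
theorem ghW_eq_ghP : ∀ j ∈ ({1, 2, 3} : Finset ℕ), ∀ μ ∈ ({6, 7} : Finset ℕ),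
    ghW j μ = Section8dStatements.ghP j μ := by
  intro j hj μ hμ
  simp only [Finset.mem_insert, Finset.mem_singleton] at hj hμ
  rcases hj with rfl | rfl | rfl <;> rcases hμ with rfl | rfl <;> simp [ghW, Section8dStatements.ghP]

/-- `Z22:§8.u049`: supplementary `ProfileApprox6` ↔ decl of record `Section8dStatements.Step8u049`
(the dispatch tables agree on `1 ≤ j ≤ 3`). [cite: Zhang2022LandauSiegel, §8 p.48, tex L2480] -/
theorem profileApprox6_iff : ProfileApprox6 c' ↔ Section8dStatements.Step8u049 c' := by
  constructor
  · rintro ⟨C, D₀, hD⟩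
    refine ⟨C, D₀, fun D _ χ hDle hq hp j hj z hz0 hz1 => ?_⟩
    have key := hD D χ hDle hq hp j hj z hz0 hz1
    rwa [ffW_eq_ffP j hj 6 (by simp), ghW_eq_ghP j hj 6 (by simp)] at key
  · rintro ⟨C, D₀, hD⟩
    refine ⟨C, D₀, fun D _ χ hDle hq hp j hj z hz0 hz1 => ?_⟩
    have key := hD D χ hDle hq hp j hj z hz0 hz1
    rwa [← ffW_eq_ffP j hj 6 (by simp), ← ghW_eq_ghP j hj 6 (by simp)] at key

/-- `Z22:§8.u050`: supplementary `ProfileApprox7` ↔ decl of record `Section8dStatements.Step8u050`.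
[cite: Zhang2022LandauSiegel, §8 p.49, tex L2483] -/
theorem profileApprox7_iff : ProfileApprox7 c' ↔ Section8dStatements.Step8u050 c' := by
  constructor
  · rintro ⟨C, D₀, hD⟩
    refine ⟨C, D₀, fun D _ χ hDle hq hp j hj z hz0 hz1 => ?_⟩
    have key := hD D χ hDle hq hp j hj z hz0 hz1
    rwa [ffW_eq_ffP j hj 7 (by simp), ghW_eq_ghP j hj 7 (by simp)] at key
  · rintro ⟨C, D₀, hD⟩
    refine ⟨C, D₀, fun D _ χ hDle hq hp j hj z hz0 hz1 => ?_⟩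
    have key := hD D χ hDle hq hp j hj z hz0 hz1
    rwa [← ffW_eq_ffP j hj 7 (by simp), ← ghW_eq_ghP j hj 7 (by simp)] at key

/-- `Z22:(8.13)`: the decl of record `Section8dStatements.Eq813` READS, verbatim, as the conjunction of
this file's printed forms `ff16_eq ∧ gh16_eq` (both files transcribe the same page; both proved:
`Section8dStatements.eq813_holds`, `ff16_eq`, `gh16_eq`). [cite: Zhang2022LandauSiegel, §8 (8.13) p.49, tex L2487] -/
theorem eq813_iff_forms : Section8dStatements.Eq813 ↔ ∀ z : ℝ,
    ff16 z = (1 + π * I / 2 * z) * cexp (3 * π * I / 2 * z) ∧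
      gh16 z = 8 / 3 + (-5 / 3 - π * I / 2 * z) * cexp (-3 * π * I / 2 * z) := Iff.rfl

/-- `Z22:(8.14)`: `Section8dStatements.Eq814` READS as `ff26_eq ∧ gh26_eq`.
[cite: Zhang2022LandauSiegel, §8 (8.14) p.49, tex L2490] -/
theorem eq814_iff_forms : Section8dStatements.Eq814 ↔ ∀ z : ℝ,
    ff26 z = (1 - π * I / 2 * z) * cexp (3 * π * I / 2 * z) ∧
      gh26 z = 4 / 3 + (-1 / 3 + π * I / 2 * z) * cexp (-3 * π * I / 2 * z) := Iff.rfl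

end Bridges

/-! ## Bridge for `Z22:§8.u044`: the `(d,r)`-double sum vs the grouping by `n = dr` -/

section Bridge844

variable (c' : ℝ)

/-- Reindexing a double sum over `1 ≤ d, r < N` restricted to `dr ∈ S` (all `n ∈ S` below `N`) as a
sum over `n ∈ S` of the sum over the factorisations `n = dr` (`Nat.divisorsAntidiagonal`).
[cite: Zhang2022LandauSiegel, §8 p.47–48 ("substituting `n = dr`")] -/
theorem sum_sum_ite_mem_eq_sum_antidiagonal (N : ℕ) (S : Finset ℕ) (hS : ∀ n ∈ S, 1 ≤ n ∧ n < N)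
    (f : ℕ → ℕ → ℕ → ℂ) :
    (∑ d ∈ Finset.Ico 1 N, ∑ r ∈ Finset.Ico 1 N, if d * r ∈ S then f d r (d * r) else 0) =
      ∑ n ∈ S, ∑ p ∈ Nat.divisorsAntidiagonal n, f p.1 p.2 n := by
  classical
  rw [← Finset.sum_product', Finset.sum_sigma', ← Finset.sum_filter]
  refine Finset.sum_bij' (fun x _ => ⟨x.1 * x.2, x⟩) (fun y _ => y.2) ?_ ?_ ?_ ?_ ?_
  · rintro ⟨d, r⟩ hx
    simp only [Finset.mem_filter, Finset.mem_product, Finset.mem_Ico] at hx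
    have hd : d ≠ 0 := Nat.pos_iff_ne_zero.mp hx.1.1.1
    have hr : r ≠ 0 := Nat.pos_iff_ne_zero.mp hx.1.2.1
    simp [Finset.mem_sigma, Nat.mem_divisorsAntidiagonal, hx.2, hd, hr]
  · rintro ⟨n, ⟨d, r⟩⟩ hy
    simp only [Finset.mem_sigma, Nat.mem_divisorsAntidiagonal] at hy
    obtain ⟨hn, hdr, hn0⟩ := hy
    have h1 := hS n hn
    have hd0 : 0 < d := Nat.pos_of_ne_zero (fun h => hn0 (by rw [← hdr, h, zero_mul]))
    have hr0 : 0 < r := Nat.pos_of_ne_zero (fun h => hn0 (by rw [← hdr, h, mul_zero]))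
    have hdn : d ≤ n := by rw [← hdr]; exact Nat.le_mul_of_pos_right d hr0
    have hrn : r ≤ n := by rw [← hdr]; exact Nat.le_mul_of_pos_left r hd0
    simp only [Finset.mem_filter, Finset.mem_product, Finset.mem_Ico]
    exact ⟨⟨⟨hd0, lt_of_le_of_lt hdn h1.2⟩, ⟨hr0, lt_of_le_of_lt hrn h1.2⟩⟩, by rw [hdr]; exact hn⟩
  · rintro ⟨d, r⟩ _; rfl
  · rintro ⟨n, ⟨d, r⟩⟩ hy
    simp only [Finset.mem_sigma, Nat.mem_divisorsAntidiagonal] at hy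
    obtain ⟨_, hdr, _⟩ := hy
    simp [hdr]
  · rintro ⟨d, r⟩ _
    rfl

/-- `Z22:§8.u044`: supplementary `SjGathered` ↔ decl of record `Section8cStatements.Step8u044`: the
double sum over `d, r < ⌈PT⁻²⌉` with the indicator of `dr < P₂` (resp. `P₂ ≤ dr < P₁`) equals the sum
over `n < P₂` (resp. `P₂ ≤ n < P₁`) of the sum over the factorisations `n = dr`, once `P₁ ≤ PT⁻²`
(`𝓛 ≥ 2`, `Skeleton.P1_le_P_div_T_sq`); both statements are eventual, so they are equivalent.
[cite: Zhang2022LandauSiegel, §8 p.47, tex L2437] -/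
theorem sjGathered_iff : SjGathered c' ↔ Section8cStatements.Step8u044 c' := by
  classical
  -- the two main terms agree for `D ≥ 8`
  have hmain : ∀ (D : ℕ) [NeZero D] (χ : DirichletCharacter ℂ D) (j : ℕ), 8 ≤ D →
      (deriv χ.LFunction 1 ^ 2 *
            (∑ d ∈ Finset.Ico 1 (Nsupp D), ∑ r ∈ Finset.Ico 1 (Nsupp D),
              if ((d * r : ℕ) : ℝ) < Skeleton.P2 D then
                wDR c' χ j d r * FBr c' D j (d * r : ℕ) * GBr c' D j (d * r : ℕ) else 0) +
          deriv χ.LFunction 1 ^ 2 *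
            (∑ d ∈ Finset.Ico 1 (Nsupp D), ∑ r ∈ Finset.Ico 1 (Nsupp D),
              if Skeleton.P2 D ≤ ((d * r : ℕ) : ℝ) ∧ ((d * r : ℕ) : ℝ) < Skeleton.P1 D then
                wDR c' χ j d r * (frakfW c' D j 6 (Skeleton.P1 D / (d * r : ℕ)) *
                  frakgW c' D j 6 (Skeleton.P1 D / (d * r : ℕ)) / (Real.log (Skeleton.P1 D) : ℂ) ^ 2)
              else 0)) =
        (deriv χ.LFunction 1 ^ 2 *
            (∑ n ∈ Finset.Ico 1 ⌈Skeleton.P2 D⌉₊, ∑ p ∈ Nat.divisorsAntidiagonal n,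
              Section8cStatements.arithW c' χ j p.1 p.2 *
                (Section8cStatements.mFac c' D j n * Section8cStatements.nFac c' D j n)) +
          deriv χ.LFunction 1 ^ 2 *
            (∑ n ∈ Finset.Ico ⌈Skeleton.P2 D⌉₊ ⌈Skeleton.P1 D⌉₊, ∑ p ∈ Nat.divisorsAntidiagonal n,
              Section8cStatements.arithW c' χ j p.1 p.2 * Section8cStatements.diagFac c' D j n)) := by
    intro D _ χ j hD8
    -- `𝓛 ≥ 2` for `D ≥ 8` (`e² < 8`)
    have hL2 : 2 ≤ ell D := by
      have hD0 : (0 : ℝ) < D := by exact_mod_cast (lt_of_lt_of_le (by norm_num) hD8 : 0 < D)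
      rw [ell, Real.le_log_iff_exp_le hD0]
      have h2 : Real.exp 2 = Real.exp 1 ^ 2 := by rw [← Real.exp_nat_mul]; norm_num
      calc Real.exp 2 = Real.exp 1 ^ 2 := h2
        _ ≤ 2.7182818286 ^ 2 := by gcongr; exact Real.exp_one_lt_d9.le
        _ ≤ 8 := by norm_num
        _ ≤ (D : ℝ) := by exact_mod_cast hD8
    -- `P₁ ≤ PT⁻²` for `𝓛 ≥ 2` (as `Skeleton.P1_le_P_div_T_sq`, restated locally to keep imports small)
    have hP1le : Skeleton.P1 D ≤ bigP D / bigT D ^ 2 := by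
      have h9 : bigP D / bigT D ^ 2 = Real.exp (ell D ^ 9 - 2 * ell D ^ (1.1 : ℝ)) := by
        rw [bigP, bigT, ← Real.exp_nat_mul, ← Real.exp_sub]; norm_num
      have h1 : Skeleton.P1 D = Real.exp (0.504 * ell D ^ 9) := by
        rw [Skeleton.P1, bigP, ← Real.exp_mul, mul_comm]
      rw [h1, h9, Real.exp_le_exp]
      have hL1 : (1 : ℝ) ≤ ell D := by linarith
      have hpow : ell D ^ (1.1 : ℝ) ≤ ell D ^ (2 : ℝ) :=
        Real.rpow_le_rpow_of_exponent_le hL1 (by norm_num)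
      rw [Real.rpow_two] at hpow
      have h7 : (128 : ℝ) ≤ ell D ^ 7 := by
        calc (128 : ℝ) = 2 ^ 7 := by norm_num
          _ ≤ ell D ^ 7 := pow_le_pow_left₀ (by norm_num) hL2 7
      have hsq : 0 ≤ ell D ^ 2 := sq_nonneg _
      have h3 : 2 * ell D ^ (1.1 : ℝ) ≤ 0.496 * ell D ^ 9 := by
        calc 2 * ell D ^ (1.1 : ℝ) ≤ 2 * ell D ^ 2 := by linarith
          _ ≤ 0.496 * (ell D ^ 7 * ell D ^ 2) := by nlinarith
          _ = 0.496 * ell D ^ 9 := by ring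
      linarith
    -- `P₂ ≤ P₁` (as `Skeleton.P2_le_P1`)
    have hP2leP1 : Skeleton.P2 D ≤ Skeleton.P1 D := by
      have hP : 1 ≤ bigP D := by
        rw [bigP]; exact Real.one_le_exp (pow_nonneg (Real.log_natCast_nonneg D) 9)
      have hT : 1 ≤ bigT D ^ 10 :=
        one_le_pow₀ (by rw [bigT]; exact Real.one_le_exp (Real.rpow_nonneg (Real.log_natCast_nonneg D) _))
      calc Skeleton.P2 D = bigP D ^ (0.5 : ℝ) / bigT D ^ 10 := rfl
        _ ≤ bigP D ^ (0.5 : ℝ) := div_le_self (by positivity) hT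
        _ ≤ bigP D ^ (0.504 : ℝ) := Real.rpow_le_rpow_of_exponent_le hP (by norm_num)
    have hP1N : ⌈Skeleton.P1 D⌉₊ ≤ Nsupp D := Nat.ceil_mono hP1le
    have hP2P1 : ⌈Skeleton.P2 D⌉₊ ≤ ⌈Skeleton.P1 D⌉₊ := Nat.ceil_mono hP2leP1
    have hS1 : ∀ n ∈ Finset.Ico 1 ⌈Skeleton.P2 D⌉₊, 1 ≤ n ∧ n < Nsupp D := by
      intro n hn
      rw [Finset.mem_Ico] at hn
      exact ⟨hn.1, lt_of_lt_of_le hn.2 (le_trans hP2P1 hP1N)⟩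
    have hS2 : ∀ n ∈ Finset.Ico ⌈Skeleton.P2 D⌉₊ ⌈Skeleton.P1 D⌉₊, 1 ≤ n ∧ n < Nsupp D := by
      intro n hn
      rw [Finset.mem_Ico] at hn
      have h1 : 1 ≤ ⌈Skeleton.P2 D⌉₊ := Nat.one_le_iff_ne_zero.mpr
        (Nat.pos_iff_ne_zero.mp (Nat.ceil_pos.mpr (P2_pos D)))
      exact ⟨le_trans h1 hn.1, lt_of_lt_of_le hn.2 hP1N⟩
    -- convert the real-valued indicators into membership in the `n`-ranges
    have hind1 : ∀ d r : ℕ, 1 ≤ d → 1 ≤ r →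
        ((((d * r : ℕ) : ℝ) < Skeleton.P2 D) ↔ d * r ∈ Finset.Ico 1 ⌈Skeleton.P2 D⌉₊) := by
      intro d r hd hr
      rw [Finset.mem_Ico, Nat.lt_ceil]
      exact ⟨fun h => ⟨Nat.mul_pos hd hr, h⟩, fun h => h.2⟩
    have hind2 : ∀ d r : ℕ,
        ((Skeleton.P2 D ≤ ((d * r : ℕ) : ℝ) ∧ ((d * r : ℕ) : ℝ) < Skeleton.P1 D) ↔
          d * r ∈ Finset.Ico ⌈Skeleton.P2 D⌉₊ ⌈Skeleton.P1 D⌉₊) := by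
      intro d r
      rw [Finset.mem_Ico, Nat.ceil_le, Nat.lt_ceil]
    have hsum1 : (∑ d ∈ Finset.Ico 1 (Nsupp D), ∑ r ∈ Finset.Ico 1 (Nsupp D),
        if ((d * r : ℕ) : ℝ) < Skeleton.P2 D then
          wDR c' χ j d r * FBr c' D j (d * r : ℕ) * GBr c' D j (d * r : ℕ) else 0) =
        ∑ d ∈ Finset.Ico 1 (Nsupp D), ∑ r ∈ Finset.Ico 1 (Nsupp D),
          if d * r ∈ Finset.Ico 1 ⌈Skeleton.P2 D⌉₊ then
            Section8cStatements.arithW c' χ j d r *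
              (Section8cStatements.mFac c' D j ((d * r : ℕ) : ℝ) *
                Section8cStatements.nFac c' D j ((d * r : ℕ) : ℝ))
          else 0 := by
      refine Finset.sum_congr rfl (fun d hd => Finset.sum_congr rfl (fun r hr => ?_))
      rw [Finset.mem_Ico] at hd hr
      rw [if_congr (hind1 d r hd.1 hr.1) rfl rfl]
      split_ifs
      · rw [wDR_eq_arithW, FBr_eq_mFac, GBr_eq_nFac]; ring
      · rfl
    have hsum2 : (∑ d ∈ Finset.Ico 1 (Nsupp D), ∑ r ∈ Finset.Ico 1 (Nsupp D),
        if Skeleton.P2 D ≤ ((d * r : ℕ) : ℝ) ∧ ((d * r : ℕ) : ℝ) < Skeleton.P1 D then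
          wDR c' χ j d r * (frakfW c' D j 6 (Skeleton.P1 D / (d * r : ℕ)) *
            frakgW c' D j 6 (Skeleton.P1 D / (d * r : ℕ)) / (Real.log (Skeleton.P1 D) : ℂ) ^ 2)
        else 0) =
        ∑ d ∈ Finset.Ico 1 (Nsupp D), ∑ r ∈ Finset.Ico 1 (Nsupp D),
          if d * r ∈ Finset.Ico ⌈Skeleton.P2 D⌉₊ ⌈Skeleton.P1 D⌉₊ then
            Section8cStatements.arithW c' χ j d r *
              Section8cStatements.diagFac c' D j ((d * r : ℕ) : ℝ)
          else 0 := by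
      refine Finset.sum_congr rfl (fun d _ => Finset.sum_congr rfl (fun r _ => ?_))
      rw [if_congr (hind2 d r) rfl rfl]
      split_ifs
      · rw [wDR_eq_arithW]; rfl
      · rfl
    rw [hsum1, hsum2,
      sum_sum_ite_mem_eq_sum_antidiagonal (Nsupp D) _ hS1 (fun d r n =>
        Section8cStatements.arithW c' χ j d r *
          (Section8cStatements.mFac c' D j n * Section8cStatements.nFac c' D j n)),
      sum_sum_ite_mem_eq_sum_antidiagonal (Nsupp D) _ hS2 (fun d r n =>
        Section8cStatements.arithW c' χ j d r * Section8cStatements.diagFac c' D j n)]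
  constructor
  · intro h ε hε
    obtain ⟨D₀, hD⟩ := h ε hε
    refine ⟨max D₀ 8, fun D _ χ hDle hq hp hA j hj => ?_⟩
    have key := hD D χ (le_trans (le_max_left _ _) hDle) hq hp hA j hj
    rwa [hmain D χ j (le_trans (le_max_right _ _) hDle)] at key
  · intro h ε hε
    obtain ⟨D₀, hD⟩ := h ε hε
    refine ⟨max D₀ 8, fun D _ χ hDle hq hp hA j hj => ?_⟩
    have key := hD D χ (le_trans (le_max_left _ _) hDle) hq hp hA j hj
    rwa [← hmain D χ j (le_trans (le_max_right _ _) hDle)] at key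

end Bridge844

/-! ## Discharges of the two EXACT arithmetic identities `Z22:§8.u045` (`MoebiusLocalFactorIdentity`) and
`Z22:(8.10)` (`Eq810`), with the complex character values as printed

Complex-weight ports of `Section8ArithmeticIdentity.sum_squarefree_divisors_local` and
`Section8ArithmeticIdentity.sum_squarefree_divisors_PiLocal` (the same identities for a REAL weight `c`): the binomial
expansion of `∏_{q ∣ n} (q⁻¹ + h(q))` over the subsets of the prime factors of `n`, i.e. over the squarefree divisors
`r ∣ n`, to which the factor `|μ(r)|` restricts the divisor sums of the typed claims. -/

section ArithmeticIdentities

/-- The binomial expansion behind the display before (8.10), complex weights: for `n ≠ 0`,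
`Σ_{r ∣ n squarefree} r⁻¹ ∏_{q ∣ n, q ∤ r} h(q) = ∏_{q ∣ n} (q⁻¹ + h(q))`.
[cite: Zhang2022LandauSiegel, §8 p.47 (before (8.10))] -/
theorem sum_squarefree_divisors_prod_sdiff_complex (h : ℕ → ℂ) {n : ℕ} (hn : n ≠ 0) :
    ∑ r ∈ n.divisors with Squarefree r,
        (1 / (r : ℂ)) * ∏ q ∈ n.primeFactors \ r.primeFactors, h q
      = ∏ q ∈ n.primeFactors, (1 / (q : ℂ) + h q) := by
  rw [Finset.prod_add, Nat.sum_divisors_filter_squarefree hn]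
  have hPF : (UniqueFactorizationMonoid.normalizedFactors n).toFinset = n.primeFactors := by
    rw [Nat.factors_eq]; rfl
  rw [hPF]
  refine Finset.sum_congr rfl (fun t ht => ?_)
  rw [Finset.mem_powerset] at ht
  have hprime : ∀ q ∈ t, q.Prime := fun q hq => Nat.prime_of_mem_primeFactors (ht hq)
  have hval : t.val.prod = ∏ q ∈ t, q := by rw [Finset.prod_val]; rfl
  rw [hval, Nat.primeFactors_prod hprime, Nat.cast_prod, one_div, ← Finset.prod_inv_distrib]
  simp only [one_div]

/-- `|μ(r)|` restricts a divisor sum `Σ_{r ∣ n} |μ(r)| w(r)⁻¹ F(r)` to the squarefree divisors. [folklore] -/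
private theorem sum_divisors_moebius_natAbs_eq {n : ℕ} (w F : ℕ → ℂ) :
    ∑ r ∈ n.divisors, ((ArithmeticFunction.moebius r).natAbs : ℂ) / w r * F r =
      ∑ r ∈ n.divisors with Squarefree r, (1 / w r) * F r := by
  rw [Finset.sum_filter]
  refine Finset.sum_congr rfl (fun r _ => ?_)
  by_cases hr : Squarefree r
  · rw [if_pos hr, ArithmeticFunction.moebius_apply_of_squarefree hr]
    simp [Int.natAbs_pow]
  · rw [if_neg hr, ArithmeticFunction.moebius_eq_zero_of_not_squarefree hr]
    simp

/-- **Discharge of `MoebiusLocalFactorIdentity` (`Z22:§8.u045`)**: "It can be shown, by verifying the case `n = q^k`, that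
`Σ_{n=dr} |μ(r)|r⁻¹ ∏_{(q,r)=1, q∣d} (1 − q⁻¹ − χ(q)q⁻¹) = ∏_{q∣n} (1 − χ(q)q⁻¹)`" — here by the binomial expansion over the
squarefree divisors (the multiplicativity the manuscript alludes to), exactly as the real-weight tree theorem
`sum_squarefree_divisors_local`. [cite: Zhang2022LandauSiegel, §8 p.47] -/
theorem MoebiusLocalFactorIdentity_holds : MoebiusLocalFactorIdentity := by
  intro D _ χ n hn
  rw [sum_divisors_moebius_natAbs_eq (fun r => (r : ℂ))]
  have step : ∀ r ∈ n.divisors.filter Squarefree,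
      (1 / (r : ℂ)) * ∏ q ∈ (n / r).primeFactors with Nat.Coprime q r,
          (1 - (q : ℂ)⁻¹ - χ (q : ZMod D) * (q : ℂ)⁻¹)
        = (1 / (r : ℂ)) * ∏ q ∈ n.primeFactors \ r.primeFactors, (1 - (q : ℂ)⁻¹ - χ (q : ZMod D) * (q : ℂ)⁻¹) := by
    intro r hr
    rw [Finset.mem_filter, Nat.mem_divisors] at hr
    rw [primeFactors_div_filter_coprime hn hr.1.1]
  rw [Finset.sum_congr rfl step, sum_squarefree_divisors_prod_sdiff_complex _ hn]
  exact Finset.prod_congr rfl (fun q _ => by ring)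

/-- Euler's product for `φ` over `ℂ`: `φ(n) = n ∏_{q ∣ n} (1 − q⁻¹)`. [folklore] -/
private theorem totient_eq_mul_prod_complex (n : ℕ) :
    (Nat.totient n : ℂ) = n * ∏ q ∈ n.primeFactors, (1 - (q : ℂ)⁻¹) := by
  have h := Nat.totient_eq_mul_prod_factors n
  have h' : ((Nat.totient n : ℚ) : ℂ) = ((n * ∏ p ∈ n.primeFactors, (1 - (p : ℚ)⁻¹) : ℚ) : ℂ) := by
    rw [h]
  push_cast at h'
  exact h'

/-- For a prime `q`, `1 − q⁻¹ ≠ 0` in `ℂ`. [folklore] -/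
private theorem one_sub_inv_ne_zero_of_mem_primeFactors {n q : ℕ} (hq : q ∈ n.primeFactors) :
    (1 : ℂ) - (q : ℂ)⁻¹ ≠ 0 := by
  have hq1 : q ≠ 1 := (Nat.prime_of_mem_primeFactors hq).ne_one
  intro h
  rw [sub_eq_zero, eq_comm, inv_eq_one] at h
  exact hq1 (by exact_mod_cast h)

/-- For a prime `q` and a Dirichlet character `χ`, `1 − χ(q)q⁻¹ ≠ 0` (`|χ(q)| ≤ 1 < q`). [folklore] -/
private theorem one_sub_chi_mul_inv_ne_zero {D : ℕ} (χ : DirichletCharacter ℂ D) {n q : ℕ} (hq : q ∈ n.primeFactors) :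
    (1 : ℂ) - χ (q : ZMod D) * (q : ℂ)⁻¹ ≠ 0 := by
  have hqp := Nat.prime_of_mem_primeFactors hq
  have hq0 : (q : ℂ) ≠ 0 := by exact_mod_cast hqp.ne_zero
  intro h
  have hχ : χ (q : ZMod D) = q := by
    rw [sub_eq_zero] at h
    have := congrArg (· * (q : ℂ)) h
    simpa [mul_assoc, inv_mul_cancel₀ hq0] using this.symm
  have h1 := DirichletCharacter.norm_le_one χ (q : ZMod D)
  rw [hχ, Complex.norm_natCast] at h1
  have h2 : (2 : ℝ) ≤ q := by exact_mod_cast hqp.two_le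
  linarith

/-- **Discharge of `Eq810` (`Z22:(8.10)`)**: "`Σ_{n=dr} |μ(r)|φ(r)⁻¹Π(d,r) = n/φ(n)`" — the complex-weight port of the tree
theorem `sum_squarefree_divisors_PiLocal`: `φ(r)⁻¹ = r⁻¹ ∏_{q ∣ r}(1 − q⁻¹)⁻¹`, `∏_{q ∣ r}(1 − q⁻¹) ∏_{q ∣ n, q ∤ r}(1 − q⁻¹)
= φ(n)/n`, and the previous expansion; the only input on `χ` is `|χ(q)| ≤ 1 < q`. [cite: Zhang2022LandauSiegel, §8 (8.10) p.48] -/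
theorem Eq810_holds : Eq810 := by
  intro D _ χ n hn
  rw [sum_divisors_moebius_natAbs_eq (fun r => (Nat.totient r : ℂ))]
  set c : ℕ → ℂ := fun q => χ (q : ZMod D) with hc_def
  set F : ℂ := ∏ q ∈ n.primeFactors, (1 - c q * (q : ℂ)⁻¹)⁻¹ with hF
  set G : ℂ := ∏ q ∈ n.primeFactors, (1 - (q : ℂ)⁻¹) with hG
  set hh : ℕ → ℂ := fun q => 1 - (q : ℂ)⁻¹ - c q * (q : ℂ)⁻¹ with hh_def
  have hGne : G ≠ 0 := Finset.prod_ne_zero_iff.mpr (fun q hq => one_sub_inv_ne_zero_of_mem_primeFactors hq)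
  -- each term, rewritten
  have step : ∀ r ∈ n.divisors.filter Squarefree,
      (1 / (Nat.totient r : ℂ)) * PiW χ (n / r) r
        = F * G⁻¹ * ((1 / (r : ℂ)) * ∏ q ∈ n.primeFactors \ r.primeFactors, hh q) := by
    intro r hr
    rw [Finset.mem_filter, Nat.mem_divisors] at hr
    have hrn : r ∣ n := hr.1.1
    have hr0 : r ≠ 0 := by rintro rfl; exact hn (zero_dvd_iff.mp hrn)
    have hsub : r.primeFactors ⊆ n.primeFactors := Nat.primeFactors_mono hrn hn
    have hGr : ∏ q ∈ r.primeFactors, (1 - (q : ℂ)⁻¹) ≠ 0 :=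
      Finset.prod_ne_zero_iff.mpr (fun q hq => one_sub_inv_ne_zero_of_mem_primeFactors hq)
    have hGs : ∏ q ∈ n.primeFactors \ r.primeFactors, (1 - (q : ℂ)⁻¹) ≠ 0 :=
      Finset.prod_ne_zero_iff.mpr (fun q hq => one_sub_inv_ne_zero_of_mem_primeFactors (Finset.mem_sdiff.mp hq).1)
    have hsplit : (∏ q ∈ n.primeFactors \ r.primeFactors, (1 - (q : ℂ)⁻¹))
        * ∏ q ∈ r.primeFactors, (1 - (q : ℂ)⁻¹) = G := Finset.prod_sdiff hsub
    have hr0' : (r : ℂ) ≠ 0 := by exact_mod_cast hr0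
    unfold PiW
    rw [Nat.div_mul_cancel hrn, primeFactors_div_filter_coprime hn hrn, Finset.prod_div_distrib,
      totient_eq_mul_prod_complex r, ← hF]
    simp only [hh_def, hc_def]
    rw [← hsplit]
    field_simp
  rw [Finset.sum_congr rfl step, ← Finset.mul_sum, sum_squarefree_divisors_prod_sdiff_complex hh hn]
  have hprod : F * ∏ q ∈ n.primeFactors, (1 / (q : ℂ) + hh q) = 1 := by
    rw [hF, ← Finset.prod_mul_distrib]
    refine Finset.prod_eq_one (fun q hq => ?_)
    have hcq : (1 : ℂ) - c q * (q : ℂ)⁻¹ ≠ 0 := one_sub_chi_mul_inv_ne_zero χ hq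
    simp only [hh_def]
    rw [show 1 / (q : ℂ) + (1 - (q : ℂ)⁻¹ - c q * (q : ℂ)⁻¹) = 1 - c q * (q : ℂ)⁻¹ by rw [one_div]; ring]
    exact inv_mul_cancel₀ hcq
  rw [totient_eq_mul_prod_complex n, ← hG]
  have hn' : (n : ℂ) ≠ 0 := by exact_mod_cast hn
  calc F * G⁻¹ * ∏ q ∈ n.primeFactors, (1 / (q : ℂ) + hh q)
      = G⁻¹ * (F * ∏ q ∈ n.primeFactors, (1 / (q : ℂ) + hh q)) := by ring
    _ = (n : ℂ) / (n * G) := by rw [hprod]; field_simp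

end ArithmeticIdentities

end Literature.NumberTheory.LFunctions.Zhang2022.Typed.S8B
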